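import Literature.MathematicalPhysics.QuantumFieldTheory.Balaban1983to89.B9SectBH1ProbesY
import Literature.MathematicalPhysics.QuantumFieldTheory.Balaban1983to89.B9SectBStepsKSCUBlocks

/-!
# `Balaban1983to89.B9SectBH1FrameCodedY` — ★★ THE FIRST LETTERS-LEVEL (3.43) FRAME INSTANCE OVER THE CODED CARRIER: `H1Frame₃` (the V2 Hölder frame with
# the (3.42) input constant `B₀` displayed in the writing function), its step theorem, the family `KSC₅ := {KSC with h1 := KSCU.h1}` (U-letter Hölder reading,
# R13-U1), ★★ `h1_transfer_KSC₅` (the transfer field PROVED at def-Y's letters), ★★ `h1Frame₃CodedOn`, ★★ `stepH1Pos_KSC₅_on`, ★★ `stepH1Pos_KSCU_on`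
# (pub-ymgap N06 row 13: the (3.43) member of `B9SectBCodedReadingsU.SectBStepU`, G′ side)

T. Bałaban, *Propagators for lattice gauge theories in a background field*, Commun. Math. Phys. **99** (1985) 389–434
[`Balaban1985BackgroundPropagators`, "B9"]; [4] = T. Bałaban, *Propagators and renormalization transformations for lattice gauge
theories. II*, Commun. Math. Phys. **96** (1984) 223–250 [`Balaban1984PropagatorsII`].

statement-level skeleton of published theorems with citation tags; proofs where landed; nothing here is a claim about the
Yang–Mills mass gap

THE PRINTED LOCI.  Theorem 3.4 p. 400; (3.43) p. 398; p. 403 l. 1–9 (*"the same inequalities hold for G′(U′U) … of course with different constants"*, the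
letters `∇_U`, `U(Γ)` of the base `U`); (3.40) p. 397; (3.60)–(3.65) pp. 402–403 (the expansion `G′(U′U) = Σ (G′(U)V′)ⁿG′(U)`); [4] Lemma 2.1 p. 234, (2.51)–(2.52)
p. 232.

WHY THIS FILE (seat dag-n06-c gen 12; LOCATED-11 ∕ R13-U1).  The Hölder member of the Sect.-B step of record reads the continued `G′(U′U)` in U-LETTERS
(`B9SectBCodedReadingsU.KSCU`); r06's per-probe Hölder transfers (`thm34_Gp_holderLeft∕Right_uniform`, R1) are packaged by the letters-level frame
`B9SectBGpStepAtLettersV2.H1Frame₂`, never instantiated so far.  Its writing function `wH BL BR δc Bβ` cannot absorb the (3.42) input constant `B₀` that the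
right transfer's undifferentiated premise (a′) carries; §1 re-types the frame with `wH B₀ BL BR δc Bβ` (`H1Frame₃`, transfer field VERBATIM) and copies the step
theorem.  §2 is the family `KSC₅` (g7's augmented `KSC` with the U-letter Hölder member) and its (3.42) dictionaries (= `KSC`'s).  §3 ★★ `h1_transfer_KSC₅`
proves the transfer field at def-Y's letters: the probes are `B9SectBH1ProbesY.probeH` at the pairs of the block of `ζ` (anchor = the labelled block of a
point of `supp ζ`), the LEFT premise and the right premises (b′)∕(c′) are READ from the (3.43) block at the base (`quotL∕R_blockSupp_le`; the forward letter on
the right through the CROSS read `quotRF_cross_symm_le`), the premise (a′) from the (3.42) majorants (`Read342Y`) and the DISPLAYED transporter law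
`HolderLipY` (`quot_undiff_le`); the conclusions at `μ := coord(f ⊗ E)` bound every pair probe of the two printed words of `G′(U′U)`, and
`B9SectBH1ReadWriteY.h1ReadT_le_of_probes` WRITES the block.  §4 the instance `h1Frame₃CodedOn` and the steps `stepH1Pos_KSC₅_on`, ★★ `stepH1Pos_KSCU_on`
(family transfer with `hin` = g11's `hin_KSCU_on_pos` + base congruence, `hout = id`).
DISPLAYED HYPOTHESES of the consumer-facing step (beyond those of `B9SectBStepsKSCUBlocks.stepEPos_KSCU_on`): `hLip` (`Reg335 ⇒ HolderLipY c_Lip (par U) U`: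
covariant Lipschitz of the transporter inside a block — for `parSymY` = p631456 + the locality of taxi rungs, not typed) and `hnbr` (the neighbour count
above the frame's threshold `MInv`, discharged uniformly by `B9GeoNbrCountKLevelV1.exists_card_nbr_geo9Y_le_of_M`).
HONEST SCOPE.  Kernel bookkeeping: r06's theorems are CALLED, def-Y's letters READ and WRITTEN; nothing of [B9] asserted beyond the landed modules; the
transporter law is displayed; COUNT-NEUTRAL; N06 NOT discharged; one finite lattice programme at fixed ε — nothing continuum, nothing about OS positivity or
the mass gap.
-/

noncomputable section

namespace Literature.MathematicalPhysics.QuantumFieldTheory.Balaban1983to89.B9SectBH1FrameCodedY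

open B6RandomWalk (HasMajorant hasMajorant_mono BlockSupp)
open B6KLevelCensusIndexV1 (KIdx kGeo)
open B6Ineq2142KLevelV1 (β beta_level)
open B6Prop22KLevelTorusCensusEta (nKT nKT_pos hqTP hqTP_nonneg lenT_le_one geoTP_len)
open B9Thm34Ext (toB6)
open B9FromB6 (EBlock H1Block)
open B9Eq352DivFormLetters (conj coordEquiv gradLetterF gradLetterB)
open B9Eq352GradLetters (diffLetter diffLetter_inl diffLetter_inr)
open B9Thm34SectBUniformR1 (thm34_Gp_uniform)
open B9Thm34HolderGpUniformR1 (thm34_Gp_holderLeft_uniform thm34_Gp_holderRight_uniform)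
open B9SectBGpStepAtLettersV2 (GpFrame₂)
open B9SectBStepWhole (StepPos StepH1Pos)
open B9SectBCodedCarrier (CCfg Coding pullK pullS)
open B9Eq360DeltaPrimeAY (AfldY blkY)
open B9PinMembersKLevelV1 (MemberY geo9Y bg9Y)
open B9SectBGpLettersY (GVal decY coordC blkC GopC letters_base_of_gVal norm_le_one_and_inv_of_mem stencil0_geo9K)
open B9SectBGpFrameCodedY (codingYx CplxLettersY Read342Y Write342Y)
open B9SectBGpReadingsY (KSC baseY etaS_eq_eta read342Y_KSC write342Y_KSC)
open B9SectBCodedReadingsU (KSCU KACU)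
open B9SectBStepsKSCU (KACU_members_base ineq342_346_347_congr thms_KSCU_base_iff hin_KSCU_on_pos)
open B9SectBGpTransferInY (ineq343_345_congr)
open B9SectBCodedChainOnSubfamily (gpFrame₂CodedOn)
open B9SectBStepPosFamilyTransfer (stepH1Pos_of_family_pos)
open B9RWSumsReadsNbr (nbr mem_nbr)
open B9GeoNbrCountKLevelV1 (exists_card_nbr_geo9Y_le_of_M)
open B9GeoLemma21KLevelV1 (geo9Y_dist_triangle geo9Y_len_pos)
open B9RWSums347DefiniteFacesWindow (geo9Y_dist_nonneg)
open B9GeoNormsKLevelModelSignsV1 (modelSignsOn_geo9K)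
open Node00 (SiteY BlkY IBondY CfgY BallY SiteParY BondParY BondOpY liftY deltaPrimeAY kernelFamilyS GpY UboxY shiftY etaS cdS cdsS cdS_smul toKT)
open Node00.OpsYRead342 (geo9K_len_congr geo9K_dist_congr)
open B9Ineq349SiteComposite (cdSL cdsSL cdSL_apply cdsSL_apply etaS_pos supBlkS'_le)
open B9SectBH1ReadWriteY (wordS quotS h1ReadT quotS_nonneg h1ReadT_le_of_probes)
open B9SectBH1ProbesY (probeH probeH_apply norm_probeH quotS_wordS_eq Gsc symm_conj_G symm_gradF_G symm_G_negGradB symm_G_gradF cutH_inl_nonneg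
  cutH_inl_eq HolderLipY quot_undiff_le quotL_blockSupp_le quotR_blockSupp_le quotRF_cross_symm_le norm_symm_apply_le_of_hasMajorant
  blockSupp_coordEquiv_liftY)

/-! ## §1 The (3.43) frame with the (3.42) input constant displayed in the writing function -/

section Frame

universe u

variable {I : Type} (d : ℕ) (c35 : ℝ) (geo : I → B9.Geometry) (bg : I → B9.Backgrounds)
  (Gp : ∀ i, B9.KernelFamily (geo i) (bg i))
  {𝔸 : Type u} [NormedRing 𝔸] [NormedAlgebra ℂ 𝔸] [CompleteSpace 𝔸] {ι : Type} [Fintype ι] [DecidableEq ι]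
  (b : Module.Basis ι ℝ 𝔸) (κ : Type) [Fintype κ]
  (S : I → Type) [∀ i, Fintype (S i)] [∀ i, DecidableEq (S i)]
  [∀ i, Fintype (geo i).Site] [∀ i, DecidableEq (geo i).Site] [∀ i, Nonempty (geo i).Site]

/-- **THE LETTERS DICTIONARY FOR THE HÖLDER BLOCK (3.43) OF G′, V3** — `B9SectBGpStepAtLettersV2.H1Frame₂` with ONE change: the writing function `wH` takes the
(3.42) input constant `B₀` as its first argument (r06's right transfer carries the undifferentiated premise (a′), whose size is the (3.42) entry constant; the V2
shape `wH BL BR δc Bβ` cannot absorb it).  The transfer field is VERBATIM V2's.  A hypothesis structure; nothing asserted.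
[cite: Balaban1985BackgroundPropagators, Thm 3.4 p.400, Thm 3.1 (3.42)–(3.43) pp.397–398, (3.60)–(3.65) pp.402–403; Balaban1984PropagatorsII, Lemma 2.1 p.234, (2.51)–(2.52) p.232] -/
structure H1Frame₃ extends GpFrame₂ c35 geo bg Gp b κ S where
  wH : ℝ → ℝ → ℝ → ℝ → (ℝ → ℝ) → (ℝ → ℝ)
  wHδ : ℝ → ℝ
  wHδ_pos : ∀ δ : ℝ, 0 < δ → 0 < wHδ δ
  /-- THE TRANSFER (as V2, at a call rate `δc ≦ δ`): r06's per-probe (3.43) transfers for `G′(U′U)` ⇒ the (3.43) block of the family at U′U, output constant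
  `wH B₀ BL BR δc Bβ`. -/
  h1_transfer : ∀ i (α₀ : ℝ) (U U' : (bg i).Cfg) (α₁ B₀ BL BR δ δc : ℝ) (Bβ : ℝ → ℝ),
    MInv ≤ (geo i).M → 0 < α₀ → (geo i).M * α₀ ≤ aInv → (bg i).Reg335 c35 α₀ U →
    0 < α₁ → α₁ ≤ aW → (bg i).Cplx337 α₁ U U' → 0 < B₀ → 0 ≤ BL → 0 ≤ BR → 0 < δ → 0 < δc → δc ≤ δ →
    EBlock (Gp i) B₀ δ U → B9FromB6.H1Block (Gp i) Bβ δ U →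
    (∀ (D : Module.End ℝ (S i × ι → ℝ)) (Φ : (S i → 𝔸) →ₗ[ℝ] 𝔸) (y : (geo i).Site) (p₀ : S i × ι), blk i p₀.1 = y →
      ∀ (β Bh cζ : ℝ), 0 ≤ Bh → 0 ≤ cζ →
        (∀ (y' : (geo i).Site) (μ : S i × ι → ℝ) (M : ℝ),
          B6RandomWalk.BlockSupp (g := toB6 (geo i) (Rr i) (Hp i)) (fun p : S i × ι => blk i p.1) μ y' M →
          ‖Φ ((B9Eq352DivFormLetters.coordEquiv b).symm (D (Gop i U μ)))‖ ≤
            Bh * (geo i).len y ^ (1 - β) * cζ * Real.exp (-(δc * (geo i).dist y y')) * M) →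
        ∀ (y' : (geo i).Site) (μ : S i × ι → ℝ) (M : ℝ),
          B6RandomWalk.BlockSupp (g := toB6 (geo i) (Rr i) (Hp i)) (fun p : S i × ι => blk i p.1) μ y' M →
          ‖Φ ((B9Eq352DivFormLetters.coordEquiv b).symm (D (Gop i ((bg i).mul U' U) μ)))‖ ≤
            BL * Bh * (geo i).len y ^ (1 - β) * cζ * Real.exp (-(9 / 10 * δc * (geo i).dist y y')) * M) →
    (∀ (D : Module.End ℝ (S i × ι → ℝ)),
      HasMajorant (g := toB6 (geo i) (Rr i) (Hp i)) (fun p : S i × ι => blk i p.1) (Gop i U * D)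
        (fun a a' => cR * B₀ * (geo i).len a * Real.exp (-(δc * (geo i).dist a a'))) →
      ∀ (Φ : (S i → 𝔸) →ₗ[ℝ] 𝔸) (y : (geo i).Site) (p₀ : S i × ι), blk i p₀.1 = y →
      ∀ (β Bh cζ : ℝ), 0 ≤ Bh → 0 ≤ cζ →
        (∀ (y' : (geo i).Site) (μ : S i × ι → ℝ) (M : ℝ),
          B6RandomWalk.BlockSupp (g := toB6 (geo i) (Rr i) (Hp i)) (fun p : S i × ι => blk i p.1) μ y' M →
          ‖Φ ((B9Eq352DivFormLetters.coordEquiv b).symm (Gop i U μ))‖ ≤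
            Bh * (geo i).len y ^ (2 - β) * cζ * Real.exp (-(δc * (geo i).dist y y')) * M) →
        (∀ (k : κ ⊕ κ) (y' : (geo i).Site) (μ : S i × ι → ℝ) (M : ℝ),
          B6RandomWalk.BlockSupp (g := toB6 (geo i) (Rr i) (Hp i)) (fun p : S i × ι => blk i p.1) μ y' M →
          ‖Φ ((B9Eq352DivFormLetters.coordEquiv b).symm
              ((Gop i U * conj b (diffLetter (T i) (coord i U) ((((geo i).eta : ℂ))⁻¹) k)) μ))‖ ≤
            Bh * (geo i).len y ^ (1 - β) * cζ * Real.exp (-(δc * (geo i).dist y y')) * M) →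
        (∀ (y' : (geo i).Site) (μ : S i × ι → ℝ) (M : ℝ),
          B6RandomWalk.BlockSupp (g := toB6 (geo i) (Rr i) (Hp i)) (fun p : S i × ι => blk i p.1) μ y' M →
          ‖Φ ((B9Eq352DivFormLetters.coordEquiv b).symm ((Gop i U * D) μ))‖ ≤
            Bh * (geo i).len y ^ (1 - β) * cζ * Real.exp (-(δc * (geo i).dist y y')) * M) →
        ∀ (y' : (geo i).Site) (μ : S i × ι → ℝ) (M : ℝ),
          B6RandomWalk.BlockSupp (g := toB6 (geo i) (Rr i) (Hp i)) (fun p : S i × ι => blk i p.1) μ y' M →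
          ‖Φ ((B9Eq352DivFormLetters.coordEquiv b).symm ((Gop i ((bg i).mul U' U) * D) μ))‖ ≤
            BR * Bh * (geo i).len y ^ (1 - β) * cζ * Real.exp (-(9 / 10 * δc * (geo i).dist y y')) * M) →
    B9FromB6.H1Block (Gp i) (wH B₀ BL BR δc Bβ) (wHδ δc) ((bg i).mul U' U)

variable {d c35 geo bg Gp b κ S}

/-- ★ **THE (3.43)-STEP OF SECT. B FOR G′(U′U), INHABITED AT THE LETTERS (V3)**: every `H1Frame₃` inhabits `StepH1Pos d c35 geo bg Gp GA Cinv Gp` (output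
`(wH B₀ B_L B_R δr Bβ, wHδ δr)`, δr = `rate δ₀`).  Proof = V2's `stepH1Pos_of_h1Frame₂` verbatim (r06's R1 `thm34_Gp_holderLeft∕Right_uniform` + `thm34_Gp_uniform`,
`gop_eq`, the transfer field). [cite: Balaban1985BackgroundPropagators, Thm 3.4 p.400 + Thm 3.1 (3.43) p.398 + (3.60)–(3.65) pp.402–403; Balaban1984PropagatorsII, Lemma 2.1 p.234] -/
theorem stepH1Pos_of_h1Frame₃ (F : H1Frame₃ c35 geo bg Gp b κ S)
    (GA : ∀ i, B9.KernelFamily (geo i) (bg i)) (Cinv : ∀ i, B9.SiteKernel (geo i) (bg i)) :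
    StepH1Pos d c35 geo bg Gp GA Cinv Gp := by
  intro B₀ δ₀ Bβ Bε Bεβ B₁ δ₁ hB₀ hδ₀ _ _
  have hBG : 0 < F.cR * B₀ := mul_pos F.cR_pos hB₀
  have hδr : 0 < F.rate δ₀ := F.rate_pos hδ₀
  obtain ⟨aE, haE, BE, -, HE⟩ := thm34_Gp_uniform b κ (F.d261 (F.rate δ₀)) (F.rate δ₀) (F.cR * B₀) F.Cq F.a₀ F.d₀ F.M₂ (F.Λf (F.rate δ₀))
    hBG F.Cq_nonneg F.a₀_nonneg F.M₂_nonneg hδr (fun α hα => F.Λf_one_le _ α hδr hα) F.hrepr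
  obtain ⟨aL, haL, BL, hBL, HL⟩ := thm34_Gp_holderLeft_uniform b κ (F.d261 (F.rate δ₀)) (F.rate δ₀) (F.cR * B₀) F.Cq F.a₀
    F.d₀ F.M₂ (F.Λf (F.rate δ₀)) hBG F.Cq_nonneg F.a₀_nonneg F.M₂_nonneg hδr (fun α hα => F.Λf_one_le _ α hδr hα) F.hrepr
  obtain ⟨aR, haR, BR, hBR, HR⟩ := thm34_Gp_holderRight_uniform b κ (F.d261 (F.rate δ₀)) (F.rate δ₀) (F.cR * B₀) F.Cq F.a₀
    F.d₀ F.M₂ (F.Λf (F.rate δ₀)) hBG F.Cq_nonneg F.a₀_nonneg F.M₂_nonneg hδr (fun α hα => F.Λf_one_le _ α hδr hα) F.hrepr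
  refine ⟨F.Mthr (F.rate δ₀), min (min aE (min aL aR)) F.aW, F.aInv, (F.wH B₀ BL BR (F.rate δ₀) Bβ, F.wHδ (F.rate δ₀)),
    F.Mthr_pos _, lt_min (lt_min haE (lt_min haL haR)) F.aW_pos, F.aInv_pos, F.wHδ_pos _ hδr, ?_⟩
  intro i hM0 α₀ hα₀ hMa U hU hT α₁ hα₁ ha U' hU'
  have hM : F.MInv ≤ (geo i).M := F.MInv_le_of_Mthr_le hM0
  have haE' : α₁ ≤ aE := le_trans ha (le_trans (min_le_left _ _) (min_le_left _ _))
  have haL' : α₁ ≤ aL := le_trans ha (le_trans (min_le_left _ _) (le_trans (min_le_right _ _) (min_le_left _ _)))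
  have haR' : α₁ ≤ aR := le_trans ha (le_trans (min_le_left _ _) (le_trans (min_le_right _ _) (min_le_right _ _)))
  have haW : α₁ ≤ F.aW := le_trans ha (min_le_right _ _)
  obtain ⟨hΔG, hGΔ⟩ := F.reg_inv i α₀ U hM hα₀ hMa hU
  obtain ⟨h1, h2, h3, -⟩ := F.read342_le i α₀ U hM hα₀ hMa hU hB₀ hδ₀ (F.rate_le δ₀) hT.1.1.1
  obtain ⟨hkF, hsF, h337s, h337F, h337B, hA, hAτ⟩ := F.cplx i α₁ U U' hα₁ hU'
  obtain ⟨hinv1, hinv2, -, -⟩ := HE (F.T i) (F.coord i U) (F.blk i) (F.kQ i U) (F.sQ i U) (F.cfun i) (F.w i U)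
    (F.dist_nonneg i) (F.triangle i) (F.dist_self i) (F.dist_comm i) (F.len_pos i) (F.eta_le_len i) (F.eta_pos i)
    (F.h261_of i hδr (F.rate_le_cap δ₀) hM0) (F.hST_of i hδr (F.rate_le_cap δ₀) hM0) (F.unitary i U)
    (F.stencilB i) (F.stencilF i) (F.stencil0 i) (F.w_nonneg i U) (F.card_w i U) (F.hkQ i U) (F.hsQ i U) (F.hcfun i)
    hΔG hGΔ h1 h2 h3 α₁ hα₁.le haE' (F.expA i U U') (F.kF i U U') (F.sF i U U')
    hkF hsF h337s h337F h337B hA hAτ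
  have hG := F.gop_eq i ((bg i).mul U' U) _ _ (F.mul_law i α₁ U U' hα₁ hU') hinv1 hinv2
  have HL' := HL (F.T i) (F.coord i U) (F.blk i) (F.kQ i U) (F.sQ i U) (F.cfun i) (F.w i U)
    (F.dist_nonneg i) (F.triangle i) (F.dist_self i) (F.dist_comm i) (F.len_pos i) (F.eta_le_len i) (F.eta_pos i)
    (F.h261_of i hδr (F.rate_le_cap δ₀) hM0) (F.hST_of i hδr (F.rate_le_cap δ₀) hM0) (F.unitary i U)
    (F.stencilB i) (F.stencilF i) (F.stencil0 i) (F.w_nonneg i U) (F.card_w i U) (F.hkQ i U) (F.hsQ i U) (F.hcfun i)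
    hΔG hGΔ h1 h2 h3 α₁ hα₁.le haL' (F.expA i U U') (F.kF i U U') (F.sF i U U')
    hkF hsF h337s h337F h337B hA hAτ
  have HR' := HR (F.T i) (F.coord i U) (F.blk i) (F.kQ i U) (F.sQ i U) (F.cfun i) (F.w i U)
    (F.dist_nonneg i) (F.triangle i) (F.dist_self i) (F.dist_comm i) (F.len_pos i) (F.eta_le_len i) (F.eta_pos i)
    (F.h261_of i hδr (F.rate_le_cap δ₀) hM0) (F.hST_of i hδr (F.rate_le_cap δ₀) hM0) (F.unitary i U)
    (F.stencilB i) (F.stencilF i) (F.stencil0 i) (F.w_nonneg i U) (F.card_w i U) (F.hkQ i U) (F.hsQ i U) (F.hcfun i)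
    hΔG hGΔ h1 h2 h3 α₁ hα₁.le haR' (F.expA i U U') (F.kF i U U') (F.sF i U U')
    hkF hsF h337s h337F h337B hA hAτ
  rw [← hG] at HL' HR'
  exact F.h1_transfer i α₀ U U' α₁ B₀ BL BR δ₀ (F.rate δ₀) Bβ hM hα₀ hMa hU hα₁ haW hU' hB₀ hBL hBR hδ₀ hδr (F.rate_le δ₀)
    hT.1.1.1 hT.1.2.1 HL' HR'

end Frame

/-! ## §2 The family `KSC₅` (augmented (3.42) reading, U-letter Hölder member) and its (3.42) dictionaries -/

variable {d ℓ : ℕ} {hd : 1 ≤ d + 1} {hL : Odd (ℓ + 1) ∧ 1 < ℓ + 1} {b₀ b₁ : ℝ} {Mstar : ℕ}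
variable {𝔸 : Type} [NormedRing 𝔸] [NormedAlgebra ℂ 𝔸] [CompleteSpace 𝔸] [FiniteDimensional ℝ 𝔸]

section Family

variable (G : Subgroup 𝔸ˣ) (x : MemberY d ℓ hd hL b₀ b₁ Mstar) (par : SiteParY 𝔸 x.toKIdx) {ι : Type} [Fintype ι] (b : Module.Basis ι ℝ 𝔸)
  (ιB : BlkY x.toKIdx → IBondY x.toKIdx) (C37 C38 : ℝ → CfgY 𝔸 x.toKIdx → AfldY 𝔸 x.toKIdx → Prop)

/-- ★ **`KSC₅`** — g7's augmented coded reading `KSC` of NODE 00's `G′` with the Hölder member REPLACED by the U-letter one of `KSCU` (R13-U1: the operator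
`G′(dec c)`, the differences and the transporter of `base c`). The family the (3.43) frame is instantiated for.
[cite: Balaban1985BackgroundPropagators, (3.42)–(3.43) pp.397–398, Thm 3.4 p.400, p.403 l.1–9] -/
def KSC₅ : B9.KernelFamily (geo9Y x) (codingYx G x C37 C38).bg :=
  { KSC G x par C37 C38 with h1 := (KSCU G x par C37 C38).h1 }

omit [FiniteDimensional ℝ 𝔸] in
/-- the (3.42) member of `KSC₅` is `KSC`'s (`rfl`). [cite: Balaban1985BackgroundPropagators, (3.42) p.397, bookkeeping] -/
theorem KSC₅_e : (KSC₅ G x par C37 C38).e = (KSC G x par C37 C38).e := rfl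

omit [FiniteDimensional ℝ 𝔸] in
/-- the (3.43) member of `KSC₅` is `KSCU`'s (`rfl`). [cite: Balaban1985BackgroundPropagators, (3.43) p.398, bookkeeping] -/
theorem KSC₅_h1 : (KSC₅ G x par C37 C38).h1 = (KSCU G x par C37 C38).h1 := rfl

omit [FiniteDimensional ℝ 𝔸] in
/-- the (3.43) member of `KSC₅` on site arguments: the U-letter reading `h1ReadT (G′(dec c)) (par (base c)) (base c)` (`rfl`).
[cite: Balaban1985BackgroundPropagators, (3.43) p.398, p.403 l.4–7, bookkeeping] -/
theorem KSC₅_h1_inl (c : (codingYx G x C37 C38).bg.Cfg) (f : SiteY x.toKIdx → ℝ) (α : ℝ) (z : SiteY x.toKIdx → ℝ) :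
    (KSC₅ G x par C37 C38).h1 c (.inl f) α (.inl z) =
      h1ReadT x.toKIdx (GpY x.toKIdx par (decY x.toKIdx c)) (par (baseY x.toKIdx c)) (baseY x.toKIdx c) f α z := rfl

omit [FiniteDimensional ℝ 𝔸] in
/-- the (3.43) member of `KSC₅` vanishes off the (site argument, site cut-off) sector (`rfl` ×3).
[cite: Balaban1985BackgroundPropagators, (3.43) p.398, bookkeeping] -/
theorem KSC₅_h1_off (c : (codingYx G x C37 C38).bg.Cfg) (α : ℝ) :
    (∀ (f : SiteY x.toKIdx → ℝ) (zb : Node00.FBondY x.toKIdx → ℝ), (KSC₅ G x par C37 C38).h1 c (.inl f) α (.inr zb) = 0) ∧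
    (∀ (J : Node00.FBondY x.toKIdx → ℝ) (ζ : (geo9Y x).Cut), (KSC₅ G x par C37 C38).h1 c (.inr J) α ζ = 0) := by
  refine ⟨fun f zb => rfl, fun J ζ => ?_⟩
  rcases ζ with z | z <;> rfl

omit [FiniteDimensional ℝ 𝔸] in
/-- the (3.42) block of `KSC₅` IS that of `KSC`. [cite: Balaban1985BackgroundPropagators, (3.42) p.397, bookkeeping] -/
theorem eBlock_KSC₅_iff {B₀ δ : ℝ} (c : (codingYx G x C37 C38).bg.Cfg) :
    EBlock (KSC₅ G x par C37 C38) B₀ δ c ↔ EBlock (KSC G x par C37 C38) B₀ δ c := by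
  rw [EBlock, EBlock, KSC₅_e]

omit [FiniteDimensional ℝ 𝔸] in
/-- the (3.43) block of `KSC₅` IS that of `KSCU`. [cite: Balaban1985BackgroundPropagators, (3.43) p.398, bookkeeping] -/
theorem h1Block_KSC₅_iff {Bβ : ℝ → ℝ} {δ : ℝ} (c : (codingYx G x C37 C38).bg.Cfg) :
    H1Block (KSC₅ G x par C37 C38) Bβ δ c ↔ H1Block (KSCU G x par C37 C38) Bβ δ c := by
  rw [H1Block, H1Block, KSC₅_h1]

omit [FiniteDimensional ℝ 𝔸] in
/-- at a BASE configuration every member of `KSC₅` is `KSC`'s (the Hölder readings agree: `dec (base U) = base (base U) = U`).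
[cite: Balaban1985BackgroundPropagators, (3.42)–(3.47) pp.397–398, bookkeeping] -/
theorem KSC₅_members_base (U : CfgY 𝔸 x.toKIdx) :
    (∀ n, (KSC₅ G x par C37 C38).e n (.base U) = (KSC G x par C37 C38).e n (.base U)) ∧
    (KSC₅ G x par C37 C38).h1 (.base U) = (KSC G x par C37 C38).h1 (.base U) ∧
    (KSC₅ G x par C37 C38).e4 (.base U) = (KSC G x par C37 C38).e4 (.base U) ∧
    (KSC₅ G x par C37 C38).h2 (.base U) = (KSC G x par C37 C38).h2 (.base U) ∧
    (∀ n, (KSC₅ G x par C37 C38).l2 n (.base U) = (KSC G x par C37 C38).l2 n (.base U)) ∧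
    (∀ n, (KSC₅ G x par C37 C38).glob n (.base U) = (KSC G x par C37 C38).glob n (.base U)) := by
  refine ⟨fun _ => rfl, ?_, rfl, rfl, fun _ => rfl, fun _ => rfl⟩
  funext lam α ζ
  rcases lam with f | J <;> rcases ζ with z | z <;> rfl

variable [Fintype (geo9Y x).Site]

/-- the (3.42) reading dictionary of `KSC₅` is `KSC`'s. [cite: Balaban1985BackgroundPropagators, (3.42) p.397; Balaban1984PropagatorsII, (2.51) p.232] -/
theorem read342Y_KSC₅ (hι : ∀ s : BlkY x.toKIdx, β x.toKIdx.hN x.toKIdx.D x.toKIdx.hk (ιB s) = s)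
    (M₂ : ℝ) (hM₂ : 0 ≤ M₂) (hrepr : ∀ (v : 𝔸) (j : ι), |b.repr v j| ≤ M₂ * ‖v‖) (c35 MInv aInv : ℝ) :
    Read342Y G x par b ιB C37 C38 (KSC₅ G x par C37 C38) c35 (M₂ * ∑ j, ‖b j‖) MInv aInv 0 True :=
  fun α₀ U B₀ δ hM hα₀ hMa hreg hB₀ hδ hE =>
    read342Y_KSC G x par b ιB C37 C38 hι M₂ hM₂ hrepr c35 MInv aInv α₀ U B₀ δ hM hα₀ hMa hreg hB₀ hδ ((eBlock_KSC₅_iff G x par C37 C38 _).1 hE)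

omit [FiniteDimensional ℝ 𝔸] in
/-- the (3.42) writing dictionary of `KSC₅` is `KSC`'s. [cite: Balaban1985BackgroundPropagators, (3.42) p.397, p.403; Balaban1984PropagatorsII, (2.51) p.232] -/
theorem write342Y_KSC₅ (hι : ∀ s : BlkY x.toKIdx, β x.toKIdx.hN x.toKIdx.D x.toKIdx.hk (ιB s) = s)
    (M₂ : ℝ) (hM₂ : 0 ≤ M₂) (hrepr : ∀ (v : 𝔸) (j : ι), |b.repr v j| ≤ M₂ * ‖v‖) (aW : ℝ) (hC37 : ∀ β' U a, C37 β' U a → GVal G x.toKIdx U) :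
    Write342Y G x par b ιB C37 C38 (KSC₅ G x par C37 C38) (fun B _ => (M₂ * ∑ j, ‖b j‖) * B + 1) (fun δ => δ) aW 0 True :=
  fun U a α₁ B δ hα₁ hα₁W h37 hB hδ hG hDG hGD hLG =>
    (eBlock_KSC₅_iff G x par C37 C38 _).2 (write342Y_KSC G x par b ιB C37 C38 hι M₂ hM₂ hrepr aW hC37 U a α₁ B δ hα₁ hα₁W h37 hB hδ hG hDG hGD hLG)

end Family

/-! ## §3 ★★ The transfer field of the (3.43) frame PROVED at def-Y's letters for `KSC₅` -/

section Transfer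

variable [NormOneClass 𝔸] (c35 : ℝ) (G : Subgroup 𝔸ˣ) (x : MemberY d ℓ hd hL b₀ b₁ Mstar) (par : SiteParY 𝔸 x.toKIdx) {ι : Type} [Fintype ι]
  (b : Module.Basis ι ℝ 𝔸) (ιB : BlkY x.toKIdx → IBondY x.toKIdx) [Fintype (geo9Y x).Site]
  (C37 C38 : ℝ → CfgY 𝔸 x.toKIdx → AfldY 𝔸 x.toKIdx → Prop)

/-- the output writing function of the instance: `wH B₀ B_L B_R δc Bβ β = M₂·(B_L·Bh_L + B_R·Bh_R)` with `Bh_L = Σ‖b_j‖·B⁺_β`,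
`Bh_R = Σ‖b_j‖·(c_R·B₀·(1 + c_Lip) + B⁺_β·(1 + m_N·M₂Σ‖b_j‖·e^{2(d+1)δc}))`, `B⁺_β = max (Bβ β) 0`.
[cite: Balaban1985BackgroundPropagators, Thm 3.4 p.400, (3.43) p.398, p.403 («of course with different constants»)] -/
def wH5 (dd Sb M₂ cR cLip : ℝ) (mN : ℕ) (B₀ BL BR δc : ℝ) (Bβ : ℝ → ℝ) : ℝ → ℝ := fun β =>
  M₂ * (BL * (Sb * max (Bβ β) 0) + BR * (Sb * (cR * B₀ * (1 + cLip) + max (Bβ β) 0 * (1 + (mN : ℝ) * (M₂ * Sb) * Real.exp (δc * dd)))))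

omit [NormedAlgebra ℂ 𝔸] [CompleteSpace 𝔸] [FiniteDimensional ℝ 𝔸] [NormOneClass 𝔸] in
/-- `0 ≤ wH5` for nonnegative data. [cite: Balaban1985BackgroundPropagators, (3.43) p.398, bookkeeping] -/
theorem wH5_nonneg {dd Sb M₂ cR cLip : ℝ} (mN : ℕ) {B₀ BL BR δc : ℝ} (Bβ : ℝ → ℝ) (hSb : 0 ≤ Sb) (hM₂ : 0 ≤ M₂) (hcR : 0 ≤ cR)
    (hcLip : 0 ≤ cLip) (hB₀ : 0 ≤ B₀) (hBL : 0 ≤ BL) (hBR : 0 ≤ BR) (β : ℝ) : 0 ≤ wH5 dd Sb M₂ cR cLip mN B₀ BL BR δc Bβ β := by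
  unfold wH5
  have h0 : 0 ≤ max (Bβ β) 0 := le_max_right _ _
  positivity

omit [Fintype (geo9Y x).Site] in
/-- the scale length of the labelled block of a site: `ℓ(ιB(Δ(w))) = L^{j(Δ(w))}·η`.
[cite: Balaban1984PropagatorsII, (2.1) p.224 («Lʲη», «η = L^{−k}»), bookkeeping] -/
theorem len_blkC_eq (hι : ∀ s : BlkY x.toKIdx, β x.toKIdx.hN x.toKIdx.D x.toKIdx.hk (ιB s) = s) (w : SiteY x.toKIdx) :
    (geo9Y x).len (blkC x.toKIdx ιB w) = (((ℓ + 1 : ℕ) : ℝ)) ^ (blkY x.toKIdx w).1.1 * etaS x.toKIdx := by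
  have hk1 : 1 ≤ x.k := le_trans one_le_two x.hk2
  show (kGeo x.toKIdx).len (blkC x.toKIdx ιB w) = _
  rw [B6KLevelCensusIndexV1.len_eq, ← beta_level x.toKIdx.hN x.toKIdx.D x.toKIdx.hk hk1, etaS_eq_eta, div_eq_mul_inv]
  show (((ℓ + 1 : ℕ) : ℝ)) ^ (β x.toKIdx.hN x.toKIdx.D x.toKIdx.hk (ιB (blkY x.toKIdx w))).1.1 * |x.cf|⁻¹ = _
  rw [hι]

omit [NormedRing 𝔸] [NormedAlgebra ℂ 𝔸] [CompleteSpace 𝔸] [FiniteDimensional ℝ 𝔸] [NormOneClass 𝔸] [Fintype (geo9Y x).Site] in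
/-- the scale lengths are at most one: `Lʲη ≤ 1`. [cite: Balaban1984PropagatorsII, (2.1) p.224 (j ≤ k), bookkeeping] -/
theorem pow_level_mul_etaS_le_one (s : BlkY x.toKIdx) : (((ℓ + 1 : ℕ) : ℝ)) ^ s.1.1 * etaS x.toKIdx ≤ 1 := by
  have h := lenT_le_one (toKT x.toKIdx) s
  rw [geoTP_len] at h
  have hc : (((ℓ + 1 : ℕ) : ℝ)) = (ℓ : ℝ) + 1 := by push_cast; ring
  rw [hc]
  exact h

omit [FiniteDimensional ℝ 𝔸] [NormOneClass 𝔸] in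
/-- ★ **THE UNDIFFERENTIATED PROBE OF `η²T` AT A BLOCK-SUPPORTED INPUT** (r06's right-transfer premise (a′) at the letters): from the (3.42)-type block
majorants of `conj b (η²T)` (profile `ℓ²`) and of `conj b (η⁻¹∇_μ) * conj b (η²T)` (profile `ℓ`) with constant `c_B` at rate `δ`, the transporter law
`HolderLipY c_Lip` and unit norms of the transporter, for a site cut-off `ζ` supported in the block `βy` containing `w₀`:
`‖probe(coord⁻¹(conj b (η²T) μ))‖ ≦ (Σ‖b_j‖)·c_B·(1 + c_Lip)·ℓ(y₁)^{2−α}·(‖ζ‖_α + |ζ|)·e^{−δc·d(y₁,y″)}·M`, `y₁ = ιB(Δ(w₀))`, `δc ≦ δ`, `α ≦ 1`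
(`B9SectBH1ProbesY.quot_undiff_le` with the block sups read off the majorants; `ℓ ≦ 1`).
[cite: Balaban1985BackgroundPropagators, (3.40) p.397, (3.42)–(3.43) pp.397–398; Balaban1984PropagatorsII, (2.51) p.232, (2.1) p.224] -/
theorem probe_undiff_le (hι : ∀ s : BlkY x.toKIdx, β x.toKIdx.hN x.toKIdx.D x.toKIdx.hk (ιB s) = s)
    {cLip : ℝ} (hcLip : 0 ≤ cLip) {U : CfgY 𝔸 x.toKIdx}
    (hLipU : HolderLipY x.toKIdx cLip (par U) U)
    (hparU : ∀ z w : SiteY x.toKIdx, ‖((par U z w : 𝔸ˣ) : 𝔸)‖ ≤ 1 ∧ ‖(((par U z w)⁻¹ : 𝔸ˣ) : 𝔸)‖ ≤ 1)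
    (T : (SiteY x.toKIdx → 𝔸) →ₗ[ℂ] (SiteY x.toKIdx → 𝔸)) {cB δ δc : ℝ} (hcB : 0 ≤ cB) (hδcδ : δc ≤ δ)
    (hm0 : HasMajorant (g := toB6 (geo9Y x) (0 : ℝ) True) (fun p : SiteY x.toKIdx × ι => blkC x.toKIdx ιB p.1) (conj b (Gsc x.toKIdx T))
      (fun a a' => cB * (geo9Y x).len a ^ 2 * Real.exp (-(δ * (geo9Y x).dist a a'))))
    (hm1 : ∀ ν : Fin (d + 1), HasMajorant (g := toB6 (geo9Y x) (0 : ℝ) True) (fun p : SiteY x.toKIdx × ι => blkC x.toKIdx ιB p.1)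
      (conj b (gradLetterF (shiftY x.toKIdx) (UboxY x.toKIdx U) ((((etaS x.toKIdx : ℝ) : ℂ))⁻¹) ν) * conj b (Gsc x.toKIdx T))
      (fun a a' => cB * (geo9Y x).len a * Real.exp (-(δ * (geo9Y x).dist a a'))))
    {α : ℝ} (hα0 : 0 ≤ α) (hα1 : α ≤ 1) (ζ₀ : SiteY x.toKIdx → ℝ) {y : IBondY x.toKIdx}
    (hζ' : ∀ w, ζ₀ w ≠ 0 → blkY x.toKIdx w = β x.toKIdx.hN x.toKIdx.D x.toKIdx.hk y) {w₀ : SiteY x.toKIdx} (hw₀ : ζ₀ w₀ ≠ 0)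
    {μ : SiteY x.toKIdx × ι → ℝ} {y'' : IBondY x.toKIdx} {M : ℝ}
    (hμ : BlockSupp (g := toB6 (geo9Y x) (0 : ℝ) True) (fun p : SiteY x.toKIdx × ι => blkC x.toKIdx ιB p.1) μ y'' M)
    {z z' : SiteY x.toKIdx} (hne : z ≠ z') :
    ‖probeH x.toKIdx (par U) α ζ₀ z z' ((coordEquiv b).symm (conj b (Gsc x.toKIdx T) μ))‖ ≤
      ((∑ j, ‖b j‖) * (cB * (1 + cLip))) * (geo9Y x).len (blkC x.toKIdx ιB w₀) ^ (2 - α) * (geo9Y x).cutH α (Sum.inl ζ₀) *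
        Real.exp (-(δc * (geo9Y x).dist (blkC x.toKIdx ιB w₀) y'')) * M := by
  classical
  letI : Fintype (B9GeoNormsKLevelV1.geo9K x.toKIdx).Site := ‹Fintype (geo9Y x).Site›
  have hη : 0 < etaS x.toKIdx := etaS_pos x.toKIdx
  set Sb : ℝ := ∑ j, ‖b j‖ with hSb
  have hSb0 : 0 ≤ Sb := Finset.sum_nonneg fun j _ => norm_nonneg _
  set y₁ : IBondY x.toKIdx := blkC x.toKIdx ιB w₀ with hy₁
  have hblk : ∀ w, blkY x.toKIdx w = β x.toKIdx.hN x.toKIdx.D x.toKIdx.hk y → blkC x.toKIdx ιB w = y₁ := by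
    intro w hw; show ιB (blkY x.toKIdx w) = ιB (blkY x.toKIdx w₀); rw [hw, hζ' w₀ hw₀]
  have hleny₁ : 0 < (geo9Y x).len y₁ := geo9Y_len_pos x y₁
  have hlen1 : (geo9Y x).len y₁ ≤ 1 := by rw [hy₁, len_blkC_eq x ιB hι]; exact pow_level_mul_etaS_le_one x _
  have hM0 : 0 ≤ M := hμ.nonneg
  set cζ : ℝ := (geo9Y x).cutH α (Sum.inl ζ₀) with hcζ
  have hcζ0 : 0 ≤ cζ := cutH_inl_nonneg x.toKIdx α ζ₀
  have hcζeq : cζ = hqTP (toKT x.toKIdx) α ζ₀ + (toKT x.toKIdx).supF ζ₀ := cutH_inl_eq x.toKIdx α ζ₀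
  set g : SiteY x.toKIdx → 𝔸 := (coordEquiv b).symm μ with hg
  set Ψ : SiteY x.toKIdx → 𝔸 := (coordEquiv b).symm (conj b (Gsc x.toKIdx T) μ) with hΨ
  have hΨeq : Ψ = ((((etaS x.toKIdx ^ 2 : ℝ)) : ℂ)) • T g := by rw [hΨ, symm_conj_G]
  set ee : ℝ := Real.exp (-(δc * (geo9Y x).dist y₁ y'')) with hee
  have hee0 : 0 < ee := Real.exp_pos _
  have hexpδ : ∀ w, blkY x.toKIdx w = β x.toKIdx.hN x.toKIdx.D x.toKIdx.hk y → Real.exp (-(δ * (geo9Y x).dist (blkC x.toKIdx ιB w) y'')) ≤ ee := by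
    intro w hw; rw [hblk w hw, hee]
    exact Real.exp_le_exp.2 (by nlinarith [geo9Y_dist_nonneg x y₁ y''])
  -- A₀: the values of `Ψ` on the block of `ζ`
  set A₀ : ℝ := Sb * (cB * (geo9Y x).len y₁ ^ 2 * ee * M) with hA₀
  have hA₀0 : 0 ≤ A₀ := by positivity
  have h0 : ∀ w, blkY x.toKIdx w = β x.toKIdx.hN x.toKIdx.D x.toKIdx.hk y → ‖Ψ w‖ ≤ A₀ := by
    intro w hw
    have h := norm_symm_apply_le_of_hasMajorant x.toKIdx b ιB hm0 hμ w
    rw [← hΨ] at h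
    refine h.trans ?_
    have hex := hexpδ w hw
    rw [hblk w hw] at hex ⊢
    rw [hA₀]
    refine mul_le_mul_of_nonneg_left (mul_le_mul_of_nonneg_right ?_ hM0) hSb0
    have hq : 0 ≤ cB * (geo9Y x).len y₁ ^ 2 := by positivity
    nlinarith
  -- A₁: the covariant differences of `Ψ` on the block of `ζ`
  set A₁ : ℝ := etaS x.toKIdx * (Sb * (cB * (geo9Y x).len y₁ * ee * M)) with hA₁
  have hA₁0 : 0 ≤ A₁ := by positivity
  have h1 : Node00.supBlkS' x.toKIdx (β x.toKIdx.hN x.toKIdx.D x.toKIdx.hk y) (fun ν' => cdS x.toKIdx U ν' Ψ) ≤ A₁ := by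
    refine supBlkS'_le x.toKIdx _ _ hA₁0 fun w ν' hw => ?_
    have hw' : blkY x.toKIdx w = β x.toKIdx.hN x.toKIdx.D x.toKIdx.hk y := hw
    have hval : ‖cdS x.toKIdx U ν' Ψ w‖ = etaS x.toKIdx * ‖(coordEquiv b).symm
        ((conj b (gradLetterF (shiftY x.toKIdx) (UboxY x.toKIdx U) ((((etaS x.toKIdx : ℝ) : ℂ))⁻¹) ν') * conj b (Gsc x.toKIdx T)) μ) w‖ := by
      rw [symm_gradF_G, hΨeq, cdS_smul, Pi.smul_apply, Pi.smul_apply, norm_smul, norm_smul, Complex.norm_real, Complex.norm_real,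
        Real.norm_eq_abs, Real.norm_eq_abs, abs_of_pos hη, abs_of_pos (pow_pos hη 2), hg]
      ring
    rw [hval, hA₁]
    refine mul_le_mul_of_nonneg_left ?_ hη.le
    refine (norm_symm_apply_le_of_hasMajorant x.toKIdx b ιB (hm1 ν') hμ w).trans ?_
    have hex := hexpδ w hw'
    rw [hblk w hw'] at hex ⊢
    refine mul_le_mul_of_nonneg_left (mul_le_mul_of_nonneg_right ?_ hM0) hSb0
    have hq : 0 ≤ cB * (geo9Y x).len y₁ := by positivity
    nlinarith
  -- the undifferentiated probe bound of `B9SectBH1ProbesY`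
  have hq := quot_undiff_le x.toKIdx (par U) U hcLip hLipU hparU hα1 ζ₀ (β x.toKIdx.hN x.toKIdx.D x.toKIdx.hk y) hζ' Ψ hA₀0 hA₁0 h0 h1 hne
  have hlenL : (((ℓ + 1 : ℕ) : ℝ)) ^ (β x.toKIdx.hN x.toKIdx.D x.toKIdx.hk y).1.1 * etaS x.toKIdx = (geo9Y x).len y₁ := by
    rw [hy₁, len_blkC_eq x ιB hι, hζ' w₀ hw₀]
  rw [hlenL] at hq
  rw [norm_probeH]
  refine hq.trans ?_
  -- arithmetic: `‖ζ‖_α·A₀ + |ζ|·c_Lip·η⁻¹·ℓ^{1−α}·A₁ ≦ (Σ‖b‖)·c_B·(1 + c_Lip)·ℓ^{2−α}·cζ·e·M`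
  set L₁ : ℝ := (geo9Y x).len y₁ with hL₁
  have hL2 : L₁ ^ 2 ≤ L₁ ^ (2 - α) := by
    rw [show L₁ ^ 2 = L₁ ^ ((2 : ℕ) : ℝ) from (Real.rpow_natCast L₁ 2).symm]
    exact Real.rpow_le_rpow_of_exponent_ge hleny₁ hlen1 (by push_cast; linarith)
  have hL12 : L₁ ^ (1 - α) * L₁ = L₁ ^ (2 - α) := by
    rw [← Real.rpow_add_one hleny₁.ne']; ring_nf
  set Q : ℝ := Sb * cB * L₁ ^ (2 - α) * ee * M with hQ
  have hQ0 : 0 ≤ Q := by positivity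
  have hhq0 : 0 ≤ hqTP (toKT x.toKIdx) α ζ₀ := hqTP_nonneg _ _ _
  have hsF0 : 0 ≤ (toKT x.toKIdx).supF ζ₀ := (abs_nonneg _).trans (B9SectBH1ProbesY.abs_le_supF x.toKIdx ζ₀ w₀)
  have ht1 : hqTP (toKT x.toKIdx) α ζ₀ * A₀ ≤ hqTP (toKT x.toKIdx) α ζ₀ * Q := by
    refine mul_le_mul_of_nonneg_left ?_ hhq0
    rw [hA₀, hQ]
    have : Sb * (cB * L₁ ^ 2 * ee * M) = (Sb * cB * ee * M) * L₁ ^ 2 := by ring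
    rw [this, show Sb * cB * L₁ ^ (2 - α) * ee * M = (Sb * cB * ee * M) * L₁ ^ (2 - α) by ring]
    exact mul_le_mul_of_nonneg_left hL2 (by positivity)
  have ht2 : (toKT x.toKIdx).supF ζ₀ * (cLip * (etaS x.toKIdx)⁻¹ * L₁ ^ (1 - α) * A₁) = (toKT x.toKIdx).supF ζ₀ * cLip * Q := by
    rw [hA₁, hQ, ← hL12]
    field_simp
  calc hqTP (toKT x.toKIdx) α ζ₀ * A₀ + (toKT x.toKIdx).supF ζ₀ * (cLip * (etaS x.toKIdx)⁻¹ * L₁ ^ (1 - α) * A₁)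
      ≤ hqTP (toKT x.toKIdx) α ζ₀ * Q + (toKT x.toKIdx).supF ζ₀ * cLip * Q := by rw [ht2]; exact add_le_add ht1 le_rfl
    _ ≤ (hqTP (toKT x.toKIdx) α ζ₀ + (toKT x.toKIdx).supF ζ₀) * (1 + cLip) * Q := by
        nlinarith [mul_nonneg hhq0 hQ0, mul_nonneg hsF0 hQ0, mul_nonneg hcLip hQ0, mul_nonneg (mul_nonneg hhq0 hcLip) hQ0]
    _ = (Sb * (cB * (1 + cLip))) * L₁ ^ (2 - α) * cζ * ee * M := by rw [hcζeq, hQ]; ring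

omit [FiniteDimensional ℝ 𝔸] [NormOneClass 𝔸] in
/-- ★ **THE PROBE OF THE CROSS WORD `ηT∇_{U,ν}` AT A BLOCK-SUPPORTED INPUT** (the forward letters of r06's premise (b′)): from the reading bounds
`h1ReadT T (par U) U g α ζ ≦ B⁺·ℓ(y₁)^{1−α}·cζ·e^{−δc·d(y₁,a′)}·|g|` (`supp g ⊂ Δ(βa′)`), unit norms of the bond variables and the neighbour count:
`‖probe(coord⁻¹((conj b (η²T) * conj b (η⁻¹∇_ν)) μ))‖ ≦ (Σ‖b_j‖)·B⁺·m_N·M₂Σ‖b_j‖·e^{2(d+1)δc}·ℓ(y₁)^{1−α}·cζ·e^{−δc·d(y₁,y″)}·M`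
(`B9SectBH1ProbesY.quotRF_cross_symm_le`; the neighbourhood costs `e^{2(d+1)δc}` by the triangle inequality).
[cite: Balaban1985BackgroundPropagators, (3.43) p.398, (3.3) p.390, (3.8) p.392; Balaban1984PropagatorsII, (2.51)–(2.52) p.232, (2.54) p.233] -/
theorem probe_cross_le (hι : ∀ s : BlkY x.toKIdx, β x.toKIdx.hN x.toKIdx.D x.toKIdx.hk (ιB s) = s)
    {M₂ : ℝ} (hM₂ : 0 ≤ M₂) (hrepr : ∀ (v : 𝔸) (j : ι), |b.repr v j| ≤ M₂ * ‖v‖) {U : CfgY 𝔸 x.toKIdx}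
    (hUu : ∀ (μ : Fin (d + 1)) (w : SiteY x.toKIdx), ‖((UboxY x.toKIdx U μ w : 𝔸ˣ) : 𝔸)‖ ≤ 1 ∧ ‖(((UboxY x.toKIdx U μ w)⁻¹ : 𝔸ˣ) : 𝔸)‖ ≤ 1)
    {mN : ℕ} (hnbrU : ∀ y' : IBondY x.toKIdx, (nbr (geo9Y x) (2 * ((d : ℝ) + 1)) y').card ≤ mN)
    (T : (SiteY x.toKIdx → 𝔸) →ₗ[ℂ] (SiteY x.toKIdx → 𝔸)) (α : ℝ) (ζ₀ : SiteY x.toKIdx → ℝ) {y₁ : IBondY x.toKIdx} {Bp cζ δc : ℝ}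
    (hBp : 0 ≤ Bp) (hcζ : 0 ≤ cζ) (hδc : 0 < δc)
    (hreadU : ∀ (g : SiteY x.toKIdx → ℝ) (a' : IBondY x.toKIdx), (geo9Y x).suppIn (Sum.inl g) a' →
      h1ReadT x.toKIdx T (par U) U g α ζ₀ ≤
        (Bp * (geo9Y x).len y₁ ^ (1 - α) * cζ * Real.exp (-(δc * (geo9Y x).dist y₁ a'))) * (geo9Y x).supNorm (Sum.inl g))
    {μ : SiteY x.toKIdx × ι → ℝ} {y'' : IBondY x.toKIdx} {M : ℝ}
    (hμ : BlockSupp (g := toB6 (geo9Y x) (0 : ℝ) True) (fun p : SiteY x.toKIdx × ι => blkC x.toKIdx ιB p.1) μ y'' M)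
    (ν' : Fin (d + 1)) {z z' : SiteY x.toKIdx} (hne : z ≠ z') :
    ‖probeH x.toKIdx (par U) α ζ₀ z z'
        ((coordEquiv b).symm ((conj b (Gsc x.toKIdx T) * conj b (gradLetterF (shiftY x.toKIdx) (UboxY x.toKIdx U) ((((etaS x.toKIdx : ℝ) : ℂ))⁻¹) ν')) μ))‖ ≤
      ((∑ j, ‖b j‖) * (Bp * ((mN : ℝ) * (M₂ * ∑ j, ‖b j‖) * Real.exp (δc * (2 * ((d : ℝ) + 1)))))) *
        ((geo9Y x).len y₁ ^ (1 - α) * cζ * Real.exp (-(δc * (geo9Y x).dist y₁ y'')) * M) := by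
  classical
  letI : Fintype (B9GeoNormsKLevelV1.geo9K x.toKIdx).Site := ‹Fintype (geo9Y x).Site›
  have hleny₁ : 0 < (geo9Y x).len y₁ := geo9Y_len_pos x y₁
  set Wf : IBondY x.toKIdx → ℝ := fun a' => Bp * (geo9Y x).len y₁ ^ (1 - α) * cζ * Real.exp (-(δc * (geo9Y x).dist y₁ a')) with hWf
  have hWf0 : ∀ a', 0 ≤ Wf a' := fun a' =>
    mul_nonneg (mul_nonneg (mul_nonneg hBp (Real.rpow_nonneg hleny₁.le _)) hcζ) (Real.exp_pos _).le
  set W₀ : ℝ := Bp * (geo9Y x).len y₁ ^ (1 - α) * cζ * (Real.exp (δc * (2 * ((d : ℝ) + 1))) * Real.exp (-(δc * (geo9Y x).dist y₁ y'')))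
    with hW₀
  have hWnbr : ∀ a' ∈ nbr (geo9Y x) (2 * ((d : ℝ) + 1)) y'', Wf a' ≤ W₀ := by
    intro a' ha'
    have hda : (geo9Y x).dist a' y'' ≤ 2 * ((d : ℝ) + 1) := mem_nbr.1 ha'
    have htri := geo9Y_dist_triangle x y₁ a' y''
    rw [hWf, hW₀]
    refine mul_le_mul_of_nonneg_left ?_ (mul_nonneg (mul_nonneg hBp (Real.rpow_nonneg hleny₁.le _)) hcζ)
    rw [← Real.exp_add]
    exact Real.exp_le_exp.2 (by nlinarith)
  calc ‖probeH x.toKIdx (par U) α ζ₀ z z'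
        ((coordEquiv b).symm ((conj b (Gsc x.toKIdx T) * conj b (gradLetterF (shiftY x.toKIdx) (UboxY x.toKIdx U) ((((etaS x.toKIdx : ℝ) : ℂ))⁻¹) ν')) μ))‖
      = quotS x.toKIdx (par U) α (wordS x.toKIdx ζ₀ (T ∘ₗ cdSL x.toKIdx U ν') ((coordEquiv b).symm μ)) z z' := by
        rw [quotS_wordS_eq, symm_G_gradF]; rfl
    _ ≤ (∑ j, ‖b j‖) * (((mN : ℝ) * (M₂ * ∑ j, ‖b j‖) * W₀) * M) :=
        quotRF_cross_symm_le x.toKIdx b ιB T (par U) U hι hM₂ hrepr hUu hnbrU α ζ₀ y'' hWf0 hWnbr hreadU μ hμ ν' hne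
    _ = _ := by rw [hW₀]; ring

omit [FiniteDimensional ℝ 𝔸] in
set_option maxHeartbeats 800000 in
/-- ★★ **THE TRANSFER FIELD OF THE (3.43) FRAME, PROVED FOR `KSC₅` AT def-Y's LETTERS** (see the module header for the proof plan): from r06's per-probe left
and right Hölder transfers for the letters of the member (hypotheses `HL`, `HR`, the shapes of `H1Frame₃.h1_transfer`), the (3.42) majorants at the base
(`hread`), the (3.42)∕(3.43) blocks of `KSC₅` at the base, the transporter law `HolderLipY` at the regular base and the neighbour count, the (3.43) block of
`KSC₅` at the coded product with `(wH5 … B₀ B_L B_R δc Bβ, 9δc∕10)`.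
[cite: Balaban1985BackgroundPropagators, Thm 3.4 p.400, (3.43) p.398, (3.40) p.397, p.403 l.1–9, (3.60)–(3.65) pp.402–403; Balaban1984PropagatorsII, (2.51)–(2.52) p.232, Lemma 2.1 p.234] -/
theorem h1_transfer_KSC₅ (hι : ∀ s : BlkY x.toKIdx, β x.toKIdx.hN x.toKIdx.D x.toKIdx.hk (ιB s) = s)
    (hG1 : ∀ u : 𝔸ˣ, u ∈ G → ‖(u : 𝔸)‖ ≤ 1) (hpar : ∀ U : CfgY 𝔸 x.toKIdx, GVal G x.toKIdx U → ∀ z w, par U z w ∈ G)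
    {M₂ : ℝ} (hM₂ : 0 ≤ M₂) (hrepr : ∀ (v : 𝔸) (j : ι), |b.repr v j| ≤ M₂ * ‖v‖)
    {cLip : ℝ} (hcLip : 0 ≤ cLip) (hLip : ∀ (α₀ : ℝ) (U : CfgY 𝔸 x.toKIdx), (bg9Y 𝔸 G x).Reg335 c35 α₀ U → HolderLipY x.toKIdx cLip (par U) U)
    {MInv : ℝ} {mN : ℕ} (hnbr : MInv ≤ (geo9Y x).M → ∀ y' : IBondY x.toKIdx, (nbr (geo9Y x) (2 * ((d : ℝ) + 1)) y').card ≤ mN)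
    {cR aInv aW : ℝ} (hcR : 0 < cR) (hread : Read342Y G x par b ιB C37 C38 (KSC₅ G x par C37 C38) c35 cR MInv aInv 0 True)
    (α₀ : ℝ) (c c' : (codingYx G x C37 C38).bg.Cfg) (α₁ B₀ BL BR δ δc : ℝ) (Bβ : ℝ → ℝ)
    (hM : MInv ≤ (geo9Y x).M) (hα₀ : 0 < α₀) (hMa : (geo9Y x).M * α₀ ≤ aInv) (hreg : (codingYx G x C37 C38).bg.Reg335 c35 α₀ c)
    (_hα₁ : 0 < α₁) (_haW : α₁ ≤ aW) (h37 : (codingYx G x C37 C38).bg.Cplx337 α₁ c c') (hB₀ : 0 < B₀) (hBL : 0 ≤ BL) (hBR : 0 ≤ BR)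
    (hδ : 0 < δ) (hδc : 0 < δc) (hδcδ : δc ≤ δ)
    (hE : EBlock (KSC₅ G x par C37 C38) B₀ δ c) (hH1 : H1Block (KSC₅ G x par C37 C38) Bβ δ c)
    (HL : ∀ (D : Module.End ℝ (SiteY x.toKIdx × ι → ℝ)) (Φ : (SiteY x.toKIdx → 𝔸) →ₗ[ℝ] 𝔸) (y : IBondY x.toKIdx) (p₀ : SiteY x.toKIdx × ι),
      blkC x.toKIdx ιB p₀.1 = y → ∀ (β Bh cζ : ℝ), 0 ≤ Bh → 0 ≤ cζ →
        (∀ (y' : IBondY x.toKIdx) (μ : SiteY x.toKIdx × ι → ℝ) (M : ℝ),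
          BlockSupp (g := toB6 (geo9Y x) (0 : ℝ) True) (fun p : SiteY x.toKIdx × ι => blkC x.toKIdx ιB p.1) μ y' M →
          ‖Φ ((coordEquiv b).symm (D (GopC x.toKIdx par b c μ)))‖ ≤
            Bh * (geo9Y x).len y ^ (1 - β) * cζ * Real.exp (-(δc * (geo9Y x).dist y y')) * M) →
        ∀ (y' : IBondY x.toKIdx) (μ : SiteY x.toKIdx × ι → ℝ) (M : ℝ),
          BlockSupp (g := toB6 (geo9Y x) (0 : ℝ) True) (fun p : SiteY x.toKIdx × ι => blkC x.toKIdx ιB p.1) μ y' M →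
          ‖Φ ((coordEquiv b).symm (D (GopC x.toKIdx par b ((codingYx G x C37 C38).bg.mul c' c) μ)))‖ ≤
            BL * Bh * (geo9Y x).len y ^ (1 - β) * cζ * Real.exp (-(9 / 10 * δc * (geo9Y x).dist y y')) * M)
    (HR : ∀ (D : Module.End ℝ (SiteY x.toKIdx × ι → ℝ)),
      HasMajorant (g := toB6 (geo9Y x) (0 : ℝ) True) (fun p : SiteY x.toKIdx × ι => blkC x.toKIdx ιB p.1) (GopC x.toKIdx par b c * D)
        (fun a a' => cR * B₀ * (geo9Y x).len a * Real.exp (-(δc * (geo9Y x).dist a a'))) →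
      ∀ (Φ : (SiteY x.toKIdx → 𝔸) →ₗ[ℝ] 𝔸) (y : IBondY x.toKIdx) (p₀ : SiteY x.toKIdx × ι), blkC x.toKIdx ιB p₀.1 = y →
      ∀ (β Bh cζ : ℝ), 0 ≤ Bh → 0 ≤ cζ →
        (∀ (y' : IBondY x.toKIdx) (μ : SiteY x.toKIdx × ι → ℝ) (M : ℝ),
          BlockSupp (g := toB6 (geo9Y x) (0 : ℝ) True) (fun p : SiteY x.toKIdx × ι => blkC x.toKIdx ιB p.1) μ y' M →
          ‖Φ ((coordEquiv b).symm (GopC x.toKIdx par b c μ))‖ ≤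
            Bh * (geo9Y x).len y ^ (2 - β) * cζ * Real.exp (-(δc * (geo9Y x).dist y y')) * M) →
        (∀ (k : Fin (d + 1) ⊕ Fin (d + 1)) (y' : IBondY x.toKIdx) (μ : SiteY x.toKIdx × ι → ℝ) (M : ℝ),
          BlockSupp (g := toB6 (geo9Y x) (0 : ℝ) True) (fun p : SiteY x.toKIdx × ι => blkC x.toKIdx ιB p.1) μ y' M →
          ‖Φ ((coordEquiv b).symm
              ((GopC x.toKIdx par b c * conj b (diffLetter (shiftY x.toKIdx) (coordC G x.toKIdx c) ((((geo9Y x).eta : ℂ))⁻¹) k)) μ))‖ ≤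
            Bh * (geo9Y x).len y ^ (1 - β) * cζ * Real.exp (-(δc * (geo9Y x).dist y y')) * M) →
        (∀ (y' : IBondY x.toKIdx) (μ : SiteY x.toKIdx × ι → ℝ) (M : ℝ),
          BlockSupp (g := toB6 (geo9Y x) (0 : ℝ) True) (fun p : SiteY x.toKIdx × ι => blkC x.toKIdx ιB p.1) μ y' M →
          ‖Φ ((coordEquiv b).symm ((GopC x.toKIdx par b c * D) μ))‖ ≤
            Bh * (geo9Y x).len y ^ (1 - β) * cζ * Real.exp (-(δc * (geo9Y x).dist y y')) * M) →
        ∀ (y' : IBondY x.toKIdx) (μ : SiteY x.toKIdx × ι → ℝ) (M : ℝ),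
          BlockSupp (g := toB6 (geo9Y x) (0 : ℝ) True) (fun p : SiteY x.toKIdx × ι => blkC x.toKIdx ιB p.1) μ y' M →
          ‖Φ ((coordEquiv b).symm ((GopC x.toKIdx par b ((codingYx G x C37 C38).bg.mul c' c) * D) μ))‖ ≤
            BR * Bh * (geo9Y x).len y ^ (1 - β) * cζ * Real.exp (-(9 / 10 * δc * (geo9Y x).dist y y')) * M) :
    H1Block (KSC₅ G x par C37 C38) (wH5 (2 * ((d : ℝ) + 1)) (∑ j, ‖b j‖) M₂ cR cLip mN B₀ BL BR δc Bβ) (9 / 10 * δc)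
      ((codingYx G x C37 C38).bg.mul c' c) := by
  classical
  letI : Fintype (B9GeoNormsKLevelV1.geo9K x.toKIdx).Site := ‹Fintype (geo9Y x).Site›
  -- the coded pair is (base U, mult a); the product is `prod U a`
  obtain ⟨U, a, rfl, rfl, hCa⟩ := (codingYx G x C37 C38).exists_of_bg_Cplx337 h37
  have hU335 : (bg9Y 𝔸 G x).Reg335 c35 α₀ U := by
    obtain ⟨U', h1, h2⟩ := (codingYx G x C37 C38).exists_of_bg_Reg335 hreg
    cases h1
    exact h2
  have hU : GVal G x.toKIdx U := hU335.1.1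
  -- notation and elementary facts
  set Sb : ℝ := ∑ j, ‖b j‖ with hSb
  have hSb0 : 0 ≤ Sb := Finset.sum_nonneg fun j _ => norm_nonneg _
  set TU : (SiteY x.toKIdx → 𝔸) →ₗ[ℂ] (SiteY x.toKIdx → 𝔸) := GpY x.toKIdx par U with hTU
  set TW : (SiteY x.toKIdx → 𝔸) →ₗ[ℂ] (SiteY x.toKIdx → 𝔸) := GpY x.toKIdx par (decY x.toKIdx (.prod U a)) with hTW
  have hη : 0 < etaS x.toKIdx := etaS_pos x.toKIdx
  have hco : coordC G x.toKIdx (.base U) = UboxY x.toKIdx U := (letters_base_of_gVal G x.toKIdx par hU).1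
  have hGopU : GopC x.toKIdx par b (.base U) = conj b (Gsc x.toKIdx TU) := by
    show conj b (((kGeo x.toKIdx).eta ^ 2) • (GpY x.toKIdx par U).restrictScalars ℝ) = conj b ((etaS x.toKIdx ^ 2) • TU.restrictScalars ℝ)
    rw [etaS_eq_eta]
  have hGopW : GopC x.toKIdx par b ((codingYx G x C37 C38).bg.mul (.mult a) (.base U)) = conj b (Gsc x.toKIdx TW) := by
    show conj b (((kGeo x.toKIdx).eta ^ 2) • (GpY x.toKIdx par (decY x.toKIdx (.prod U a))).restrictScalars ℝ) = conj b ((etaS x.toKIdx ^ 2) • TW.restrictScalars ℝ)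
    rw [etaS_eq_eta]
  have hDk : ∀ k : Fin (d + 1) ⊕ Fin (d + 1),
      diffLetter (shiftY x.toKIdx) (coordC G x.toKIdx (.base U)) ((((geo9Y x).eta : ℂ))⁻¹) k = diffLetter (shiftY x.toKIdx) (UboxY x.toKIdx U) ((((etaS x.toKIdx : ℝ) : ℂ))⁻¹) k := by
    intro k
    show diffLetter (shiftY x.toKIdx) (coordC G x.toKIdx (.base U)) ((((kGeo x.toKIdx).eta : ℝ) : ℂ))⁻¹ k = _
    rw [hco, etaS_eq_eta]
  have hUu : ∀ (μ : Fin (d + 1)) (w : SiteY x.toKIdx), ‖((UboxY x.toKIdx U μ w : 𝔸ˣ) : 𝔸)‖ ≤ 1 ∧ ‖(((UboxY x.toKIdx U μ w)⁻¹ : 𝔸ˣ) : 𝔸)‖ ≤ 1 :=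
    fun μ w => norm_le_one_and_inv_of_mem G hG1 (hU μ _)
  have hparU : ∀ z w : SiteY x.toKIdx, ‖((par U z w : 𝔸ˣ) : 𝔸)‖ ≤ 1 ∧ ‖(((par U z w)⁻¹ : 𝔸ˣ) : 𝔸)‖ ≤ 1 :=
    fun z w => norm_le_one_and_inv_of_mem G hG1 (hpar U hU z w)
  have hLipU : HolderLipY x.toKIdx cLip (par U) U := hLip α₀ U hU335
  have hnbrU := hnbr hM
  have hdd : 0 ≤ 2 * ((d : ℝ) + 1) := by positivity
  -- the (3.42) majorants of the letters at the base (rate δ)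
  obtain ⟨hm0, hm1, hm2, -⟩ := hread α₀ U B₀ δ hM hα₀ hMa hU335 hB₀ hδ hE
  have hm1' : ∀ ν : Fin (d + 1), HasMajorant (g := toB6 (geo9Y x) (0 : ℝ) True) (fun p : SiteY x.toKIdx × ι => blkC x.toKIdx ιB p.1)
      (conj b (gradLetterF (shiftY x.toKIdx) (UboxY x.toKIdx U) ((((etaS x.toKIdx : ℝ) : ℂ))⁻¹) ν) * conj b (Gsc x.toKIdx TU))
      (fun a a' => cR * B₀ * (geo9Y x).len a * Real.exp (-(δ * (geo9Y x).dist a a'))) := by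
    intro ν
    have h := hm1 (Sum.inl ν)
    rwa [hDk, diffLetter_inl, hGopU] at h
  -- the output block
  intro α lam ζ y y' hα0 hα1 hζ hlam
  have hW5 : 0 ≤ wH5 (2 * ((d : ℝ) + 1)) Sb M₂ cR cLip mN B₀ BL BR δc Bβ α :=
    wH5_nonneg mN Bβ hSb0 hM₂ hcR.le hcLip hB₀.le hBL hBR α
  have hleny : 0 < (geo9Y x).len y := geo9Y_len_pos x y
  have hcutH : 0 ≤ (geo9Y x).cutH α ζ := (modelSignsOn_geo9K x.toKIdx).cutH_nonneg α ζ
  have hsupN : 0 ≤ (geo9Y x).supNorm lam := (modelSignsOn_geo9K x.toKIdx).supNorm_nonneg lam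
  have hRHS : 0 ≤ wH5 (2 * ((d : ℝ) + 1)) Sb M₂ cR cLip mN B₀ BL BR δc Bβ α * (geo9Y x).len y ^ (1 - α) * (geo9Y x).cutH α ζ *
      Real.exp (-(9 / 10 * δc * (geo9Y x).dist y y')) * (geo9Y x).supNorm lam :=
    mul_nonneg (mul_nonneg (mul_nonneg (mul_nonneg hW5 (Real.rpow_nonneg hleny.le _)) hcutH) (Real.exp_pos _).le) hsupN
  -- only (site argument, site cut-off) is nontrivial
  rcases lam with f | J
  swap
  · rw [(KSC₅_h1_off G x par C37 C38 _ α).2 J ζ]; exact hRHS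
  rcases ζ with ζ₀ | zb
  swap
  · rw [(KSC₅_h1_off G x par C37 C38 _ α).1 f zb]; exact hRHS
  -- the U-letter reading of `G′(U′U)` at the base `U`
  rw [KSC₅_h1_inl]
  show h1ReadT x.toKIdx TW (par U) U f α ζ₀ ≤ _
  have hζ' : ∀ w, ζ₀ w ≠ 0 → blkY x.toKIdx w = β x.toKIdx.hN x.toKIdx.D x.toKIdx.hk y := hζ
  -- trivial cut-off: every probe vanishes
  by_cases hζ0 : ∀ w, ζ₀ w = 0
  · refine h1ReadT_le_of_probes x.toKIdx TW (par U) U f α ζ₀ hRHS (fun E μ z z' _ => ?_) (fun E μ z z' _ => ?_) <;>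
    · rw [quotS_wordS_eq, probeH_apply]
      simp only [hζ0, Complex.ofReal_zero, zero_smul, B9Eq39Adjoint.R_zero, sub_zero, smul_zero, norm_zero]
      exact hRHS
  push Not at hζ0
  obtain ⟨w₀, hw₀⟩ := hζ0
  -- the anchor: the labelled block of `w₀ ∈ supp ζ`
  set y₁ : IBondY x.toKIdx := blkC x.toKIdx ιB w₀ with hy₁
  have hy₁β : β x.toKIdx.hN x.toKIdx.D x.toKIdx.hk y₁ = β x.toKIdx.hN x.toKIdx.D x.toKIdx.hk y := by
    show β x.toKIdx.hN x.toKIdx.D x.toKIdx.hk (ιB (blkY x.toKIdx w₀)) = _; rw [hι, hζ' w₀ hw₀]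
  have hblk : ∀ w, blkY x.toKIdx w = β x.toKIdx.hN x.toKIdx.D x.toKIdx.hk y → blkC x.toKIdx ιB w = y₁ := by
    intro w hw; show ιB (blkY x.toKIdx w) = ιB (blkY x.toKIdx w₀); rw [hw, hζ' w₀ hw₀]
  have hlen : (geo9Y x).len y₁ = (geo9Y x).len y := geo9K_len_congr x.toKIdx hy₁β
  have hdist : ∀ t : IBondY x.toKIdx, (geo9Y x).dist y₁ t = (geo9Y x).dist y t := fun t => geo9K_dist_congr x.toKIdx hy₁β rfl
  set yL : IBondY x.toKIdx := ιB (β x.toKIdx.hN x.toKIdx.D x.toKIdx.hk y') with hyL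
  have hdistL : (geo9Y x).dist y₁ yL = (geo9Y x).dist y y' := geo9K_dist_congr x.toKIdx hy₁β (hι _)
  have hlen1 : (geo9Y x).len y₁ ≤ 1 := by rw [hy₁, len_blkC_eq x ιB hι]; exact pow_level_mul_etaS_le_one x _
  have hleny₁ : 0 < (geo9Y x).len y₁ := geo9Y_len_pos x y₁
  haveI : Nontrivial 𝔸 := NormOneClass.nontrivial
  obtain ⟨j₀⟩ := b.index_nonempty
  have hp₀ : blkC x.toKIdx ιB ((w₀, j₀) : SiteY x.toKIdx × ι).1 = y₁ := rfl
  -- constants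
  set cζ : ℝ := (geo9Y x).cutH α (Sum.inl ζ₀) with hcζ
  have hcζ0 : 0 ≤ cζ := hcutH
  have hcζeq : cζ = hqTP (toKT x.toKIdx) α ζ₀ + (toKT x.toKIdx).supF ζ₀ := cutH_inl_eq x.toKIdx α ζ₀
  set Bp : ℝ := max (Bβ α) 0 with hBp
  have hBp0 : 0 ≤ Bp := le_max_right _ _
  set BhL : ℝ := Sb * Bp with hBhL
  have hBhL0 : 0 ≤ BhL := mul_nonneg hSb0 hBp0
  set BhR : ℝ := Sb * (cR * B₀ * (1 + cLip) + Bp * (1 + (mN : ℝ) * (M₂ * Sb) * Real.exp (δc * (2 * ((d : ℝ) + 1))))) with hBhR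
  have hBhR0 : 0 ≤ BhR := by positivity
  -- the (3.43) block at the base, READ: reading bounds for scalar inputs supported in a block, at the call rate δc
  set Wf : IBondY x.toKIdx → ℝ := fun a' => Bp * (geo9Y x).len y₁ ^ (1 - α) * cζ * Real.exp (-(δc * (geo9Y x).dist y₁ a')) with hWf
  have hWf0 : ∀ a', 0 ≤ Wf a' := fun a' =>
    mul_nonneg (mul_nonneg (mul_nonneg hBp0 (Real.rpow_nonneg hleny₁.le _)) hcζ0) (Real.exp_pos _).le
  have hreadU : ∀ (g : SiteY x.toKIdx → ℝ) (a' : IBondY x.toKIdx), (geo9Y x).suppIn (Sum.inl g) a' →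
      h1ReadT x.toKIdx TU (par U) U g α ζ₀ ≤ Wf a' * (geo9Y x).supNorm (Sum.inl g) := by
    intro g a' hg
    have h := hH1 α (Sum.inl g) (Sum.inl ζ₀) y a' hα0 hα1 hζ hg
    rw [KSC₅_h1_inl] at h
    have hN : 0 ≤ (geo9Y x).supNorm (Sum.inl g) := (modelSignsOn_geo9K x.toKIdx).supNorm_nonneg _
    refine (show h1ReadT x.toKIdx TU (par U) U g α ζ₀ ≤ _ from h).trans ?_
    rw [← hlen, ← hdist]
    have hP : 0 ≤ (geo9Y x).len y₁ ^ (1 - α) * cζ := mul_nonneg (Real.rpow_nonneg hleny₁.le _) hcζ0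
    have hexp : Real.exp (-(δ * (geo9Y x).dist y₁ a')) ≤ Real.exp (-(δc * (geo9Y x).dist y₁ a')) :=
      Real.exp_le_exp.2 (by nlinarith [geo9Y_dist_nonneg x y₁ a'])
    calc Bβ α * (geo9Y x).len y₁ ^ (1 - α) * (geo9Y x).cutH α (Sum.inl ζ₀) * Real.exp (-(δ * (geo9Y x).dist y₁ a')) *
          (geo9Y x).supNorm (Sum.inl g)
        = Bβ α * (((geo9Y x).len y₁ ^ (1 - α) * cζ) * Real.exp (-(δ * (geo9Y x).dist y₁ a')) * (geo9Y x).supNorm (Sum.inl g)) := by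
          rw [hcζ]; ring
      _ ≤ Bp * (((geo9Y x).len y₁ ^ (1 - α) * cζ) * Real.exp (-(δc * (geo9Y x).dist y₁ a')) * (geo9Y x).supNorm (Sum.inl g)) := by
          refine mul_le_mul (le_max_left _ _) ?_ (mul_nonneg (mul_nonneg hP (Real.exp_pos _).le) hN) hBp0
          exact mul_le_mul_of_nonneg_right (mul_le_mul_of_nonneg_left hexp hP) hN
      _ = Wf a' * (geo9Y x).supNorm (Sum.inl g) := by rw [hWf]; ring
  -- the block support of the coordinates of the output input `f ⊗ E`
  have hBS : ∀ {E : 𝔸}, ‖E‖ ≤ 1 → BlockSupp (g := toB6 (geo9Y x) (0 : ℝ) True) (fun p : SiteY x.toKIdx × ι => blkC x.toKIdx ιB p.1)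
      (coordEquiv b (liftY f E)) yL (M₂ * (geo9Y x).supNorm (Sum.inl f)) := fun hE1 =>
    blockSupp_coordEquiv_liftY x.toKIdx b ιB hM₂ hrepr f y' hlam hE1
  ------------------------------------------------------------------
  -- LEFT WORDS: `ζη∇_{U,ν}G′(U′U)(f ⊗ E)`
  ------------------------------------------------------------------
  have hLeft : ∀ (E : BallY 𝔸) (ν : Fin (d + 1)) (z z' : SiteY x.toKIdx), z ≠ z' →
      quotS x.toKIdx (par U) α (wordS x.toKIdx ζ₀ (cdSL x.toKIdx U ν ∘ₗ TW) (liftY f (E : 𝔸))) z z' ≤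
        BL * BhL * (geo9Y x).len y₁ ^ (1 - α) * cζ * Real.exp (-(9 / 10 * δc * (geo9Y x).dist y₁ yL)) * (M₂ * (geo9Y x).supNorm (Sum.inl f)) := by
    intro E ν z z' hne
    have hE1 : ‖(E : 𝔸)‖ ≤ 1 := mem_closedBall_zero_iff.1 E.2
    set D : Module.End ℝ (SiteY x.toKIdx × ι → ℝ) := conj b (gradLetterF (shiftY x.toKIdx) (UboxY x.toKIdx U) ((((etaS x.toKIdx : ℝ) : ℂ))⁻¹) ν) with hD
    set Φ : (SiteY x.toKIdx → 𝔸) →ₗ[ℝ] 𝔸 := probeH x.toKIdx (par U) α ζ₀ z z' with hΦ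
    -- the premise at the base
    have prem : ∀ (y'' : IBondY x.toKIdx) (μ : SiteY x.toKIdx × ι → ℝ) (M : ℝ),
        BlockSupp (g := toB6 (geo9Y x) (0 : ℝ) True) (fun p : SiteY x.toKIdx × ι => blkC x.toKIdx ιB p.1) μ y'' M →
        ‖Φ ((coordEquiv b).symm (D (GopC x.toKIdx par b (.base U) μ)))‖ ≤
          BhL * (geo9Y x).len y₁ ^ (1 - α) * cζ * Real.exp (-(δc * (geo9Y x).dist y₁ y'')) * M := by
      intro y'' μ M hμ
      calc ‖Φ ((coordEquiv b).symm (D (GopC x.toKIdx par b (.base U) μ)))‖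
          = quotS x.toKIdx (par U) α (wordS x.toKIdx ζ₀ (cdSL x.toKIdx U ν ∘ₗ TU) ((coordEquiv b).symm μ)) z z' := by
            rw [quotS_wordS_eq, hGopU, ← Module.End.mul_apply, hD, symm_gradF_G]; rfl
        _ ≤ Sb * (Wf y'' * M) := quotL_blockSupp_le x.toKIdx b ιB TU (par U) U hι hM₂ hrepr α ζ₀ hWf0 hreadU hμ ν hne
        _ = BhL * (geo9Y x).len y₁ ^ (1 - α) * cζ * Real.exp (-(δc * (geo9Y x).dist y₁ y'')) * M := by rw [hWf, hBhL]; ring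
    have concl := HL D Φ y₁ (w₀, j₀) hp₀ α BhL cζ hBhL0 hcζ0 prem yL (coordEquiv b (liftY f (E : 𝔸))) _ (hBS hE1)
    calc quotS x.toKIdx (par U) α (wordS x.toKIdx ζ₀ (cdSL x.toKIdx U ν ∘ₗ TW) (liftY f (E : 𝔸))) z z'
        = ‖Φ ((coordEquiv b).symm (D (GopC x.toKIdx par b ((codingYx G x C37 C38).bg.mul (.mult a) (.base U)) (coordEquiv b (liftY f (E : 𝔸))))))‖ := by
          rw [quotS_wordS_eq, hGopW, ← Module.End.mul_apply, hD, symm_gradF_G, LinearEquiv.symm_apply_apply]; rfl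
      _ ≤ _ := concl
  ------------------------------------------------------------------
  -- RIGHT WORDS: `ζηG′(U′U)∇*_{U,ν}(f ⊗ E)`
  ------------------------------------------------------------------
  have hRight : ∀ (E : BallY 𝔸) (ν : Fin (d + 1)) (z z' : SiteY x.toKIdx), z ≠ z' →
      quotS x.toKIdx (par U) α (wordS x.toKIdx ζ₀ (TW ∘ₗ cdsSL x.toKIdx U ν) (liftY f (E : 𝔸))) z z' ≤
        BR * BhR * (geo9Y x).len y₁ ^ (1 - α) * cζ * Real.exp (-(9 / 10 * δc * (geo9Y x).dist y₁ yL)) * (M₂ * (geo9Y x).supNorm (Sum.inl f)) := by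
    intro E ν z z' hne
    have hE1 : ‖(E : 𝔸)‖ ≤ 1 := mem_closedBall_zero_iff.1 E.2
    -- the right letter IN THE FRAME's SYNTAX
    set D' : Module.End ℝ (SiteY x.toKIdx × ι → ℝ) := conj b (diffLetter (shiftY x.toKIdx) (coordC G x.toKIdx (.base U)) ((((geo9Y x).eta : ℂ))⁻¹) (Sum.inr ν))
      with hD'
    have hD'U : D' = conj b (-gradLetterB (shiftY x.toKIdx) (UboxY x.toKIdx U) ((((etaS x.toKIdx : ℝ) : ℂ))⁻¹) ν) := by rw [hD', hDk, diffLetter_inr]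
    set Φ : (SiteY x.toKIdx → 𝔸) →ₗ[ℝ] 𝔸 := probeH x.toKIdx (par U) α ζ₀ z z' with hΦ
    -- (1) the (3.42)₃ majorant of `G′(U)D′` at the call rate
    have hmaj : HasMajorant (g := toB6 (geo9Y x) (0 : ℝ) True) (fun p : SiteY x.toKIdx × ι => blkC x.toKIdx ιB p.1) (GopC x.toKIdx par b (.base U) * D')
        (fun a a' => cR * B₀ * (geo9Y x).len a * Real.exp (-(δc * (geo9Y x).dist a a'))) := by
      refine hasMajorant_mono _ (hm2 (Sum.inr ν)) fun a a' => ?_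
      refine mul_le_mul_of_nonneg_left (Real.exp_le_exp.2 (by nlinarith [geo9Y_dist_nonneg x a a'])) ?_
      exact mul_nonneg (mul_pos hcR hB₀).le (geo9Y_len_pos x a).le
    -- (2) the right-word premise at a backward letter (shared by (b′)-inr and (c′))
    have hbinr : ∀ (ν' : Fin (d + 1)) (y'' : IBondY x.toKIdx) (μ : SiteY x.toKIdx × ι → ℝ) (M : ℝ),
        BlockSupp (g := toB6 (geo9Y x) (0 : ℝ) True) (fun p : SiteY x.toKIdx × ι => blkC x.toKIdx ιB p.1) μ y'' M →
        ‖Φ ((coordEquiv b).symm ((GopC x.toKIdx par b (.base U) *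
            conj b (diffLetter (shiftY x.toKIdx) (coordC G x.toKIdx (.base U)) ((((geo9Y x).eta : ℂ))⁻¹) (Sum.inr ν'))) μ))‖ ≤
          BhR * (geo9Y x).len y₁ ^ (1 - α) * cζ * Real.exp (-(δc * (geo9Y x).dist y₁ y'')) * M := by
      intro ν' y'' μ M hμ
      have hfac : 0 ≤ (geo9Y x).len y₁ ^ (1 - α) * cζ * Real.exp (-(δc * (geo9Y x).dist y₁ y'')) * M :=
        mul_nonneg (mul_nonneg (mul_nonneg (Real.rpow_nonneg hleny₁.le _) hcζ0) (Real.exp_pos _).le) hμ.nonneg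
      calc ‖Φ ((coordEquiv b).symm ((GopC x.toKIdx par b (.base U) *
              conj b (diffLetter (shiftY x.toKIdx) (coordC G x.toKIdx (.base U)) ((((geo9Y x).eta : ℂ))⁻¹) (Sum.inr ν'))) μ))‖
          = quotS x.toKIdx (par U) α (wordS x.toKIdx ζ₀ (TU ∘ₗ cdsSL x.toKIdx U ν') ((coordEquiv b).symm μ)) z z' := by
            rw [quotS_wordS_eq, hDk, diffLetter_inr, hGopU, symm_G_negGradB, map_neg, norm_neg]; rfl
        _ ≤ Sb * (Wf y'' * M) := quotR_blockSupp_le x.toKIdx b ιB TU (par U) U hι hM₂ hrepr α ζ₀ hWf0 hreadU hμ ν' hne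
        _ = (Sb * Bp) * ((geo9Y x).len y₁ ^ (1 - α) * cζ * Real.exp (-(δc * (geo9Y x).dist y₁ y'')) * M) := by rw [hWf]; ring
        _ ≤ BhR * ((geo9Y x).len y₁ ^ (1 - α) * cζ * Real.exp (-(δc * (geo9Y x).dist y₁ y'')) * M) := by
            refine mul_le_mul_of_nonneg_right ?_ hfac
            rw [hBhR]
            refine mul_le_mul_of_nonneg_left ?_ hSb0
            have h1 : 0 ≤ cR * B₀ * (1 + cLip) := by positivity
            have h2 : Bp ≤ Bp * (1 + (mN : ℝ) * (M₂ * Sb) * Real.exp (δc * (2 * ((d : ℝ) + 1)))) :=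
              le_mul_of_one_le_right hBp0 (le_add_of_nonneg_right (by positivity))
            linarith
        _ = BhR * (geo9Y x).len y₁ ^ (1 - α) * cζ * Real.exp (-(δc * (geo9Y x).dist y₁ y'')) * M := by ring
    -- (3) premise (a′): the undifferentiated probe (`probe_undiff_le`)
    have hm0' : HasMajorant (g := toB6 (geo9Y x) (0 : ℝ) True) (fun p : SiteY x.toKIdx × ι => blkC x.toKIdx ιB p.1) (conj b (Gsc x.toKIdx TU))
        (fun a a' => cR * B₀ * (geo9Y x).len a ^ 2 * Real.exp (-(δ * (geo9Y x).dist a a'))) := by rw [← hGopU]; exact hm0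
    have prema : ∀ (y'' : IBondY x.toKIdx) (μ : SiteY x.toKIdx × ι → ℝ) (M : ℝ),
        BlockSupp (g := toB6 (geo9Y x) (0 : ℝ) True) (fun p : SiteY x.toKIdx × ι => blkC x.toKIdx ιB p.1) μ y'' M →
        ‖Φ ((coordEquiv b).symm (GopC x.toKIdx par b (.base U) μ))‖ ≤
          BhR * (geo9Y x).len y₁ ^ (2 - α) * cζ * Real.exp (-(δc * (geo9Y x).dist y₁ y'')) * M := by
      intro y'' μ M hμ
      have h := probe_undiff_le x par b ιB hι hcLip hLipU hparU TU (mul_pos hcR hB₀).le hδcδ hm0' hm1' hα0 hα1.le ζ₀ hζ' hw₀ hμ hne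
      rw [hGopU]
      refine h.trans ?_
      have hfac : 0 ≤ (geo9Y x).len y₁ ^ (2 - α) * cζ * Real.exp (-(δc * (geo9Y x).dist y₁ y'')) * M :=
        mul_nonneg (mul_nonneg (mul_nonneg (Real.rpow_nonneg hleny₁.le _) hcζ0) (Real.exp_pos _).le) hμ.nonneg
      have hle : Sb * (cR * B₀ * (1 + cLip)) ≤ BhR := by
        rw [hBhR]
        exact mul_le_mul_of_nonneg_left (le_add_of_nonneg_right (by positivity)) hSb0
      calc (Sb * (cR * B₀ * (1 + cLip))) * (geo9Y x).len y₁ ^ (2 - α) * cζ * Real.exp (-(δc * (geo9Y x).dist y₁ y'')) * M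
          = (Sb * (cR * B₀ * (1 + cLip))) * ((geo9Y x).len y₁ ^ (2 - α) * cζ * Real.exp (-(δc * (geo9Y x).dist y₁ y'')) * M) := by ring
        _ ≤ BhR * ((geo9Y x).len y₁ ^ (2 - α) * cζ * Real.exp (-(δc * (geo9Y x).dist y₁ y'')) * M) := mul_le_mul_of_nonneg_right hle hfac
        _ = _ := by ring
    -- (4) premise (b′): every letter `∇♯_k` on the right of `G′(U)` (forward letters through the CROSS read `probe_cross_le`)
    have premb : ∀ (k : Fin (d + 1) ⊕ Fin (d + 1)) (y'' : IBondY x.toKIdx) (μ : SiteY x.toKIdx × ι → ℝ) (M : ℝ),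
        BlockSupp (g := toB6 (geo9Y x) (0 : ℝ) True) (fun p : SiteY x.toKIdx × ι => blkC x.toKIdx ιB p.1) μ y'' M →
        ‖Φ ((coordEquiv b).symm ((GopC x.toKIdx par b (.base U) *
            conj b (diffLetter (shiftY x.toKIdx) (coordC G x.toKIdx (.base U)) ((((geo9Y x).eta : ℂ))⁻¹) k)) μ))‖ ≤
          BhR * (geo9Y x).len y₁ ^ (1 - α) * cζ * Real.exp (-(δc * (geo9Y x).dist y₁ y'')) * M := by
      intro k y'' μ M hμ
      rcases k with ν' | ν'
      · have h := probe_cross_le x par b ιB hι hM₂ hrepr hUu hnbrU TU α ζ₀ hBp0 hcζ0 hδc hreadU hμ ν' hne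
        rw [hDk, diffLetter_inl, hGopU]
        refine h.trans ?_
        have hfac : 0 ≤ (geo9Y x).len y₁ ^ (1 - α) * cζ * Real.exp (-(δc * (geo9Y x).dist y₁ y'')) * M :=
          mul_nonneg (mul_nonneg (mul_nonneg (Real.rpow_nonneg hleny₁.le _) hcζ0) (Real.exp_pos _).le) hμ.nonneg
        have hle : Sb * (Bp * ((mN : ℝ) * (M₂ * Sb) * Real.exp (δc * (2 * ((d : ℝ) + 1))))) ≤ BhR := by
          rw [hBhR]
          refine mul_le_mul_of_nonneg_left ?_ hSb0
          have h1 : 0 ≤ cR * B₀ * (1 + cLip) := by positivity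
          have h2 : Bp * ((mN : ℝ) * (M₂ * Sb) * Real.exp (δc * (2 * ((d : ℝ) + 1)))) ≤
              Bp * (1 + (mN : ℝ) * (M₂ * Sb) * Real.exp (δc * (2 * ((d : ℝ) + 1)))) :=
            mul_le_mul_of_nonneg_left (le_add_of_nonneg_left zero_le_one) hBp0
          linarith
        calc (∑ j, ‖b j‖) * (Bp * ((mN : ℝ) * (M₂ * ∑ j, ‖b j‖) * Real.exp (δc * (2 * ((d : ℝ) + 1))))) *
              ((geo9Y x).len y₁ ^ (1 - α) * cζ * Real.exp (-(δc * (geo9Y x).dist y₁ y'')) * M)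
            ≤ BhR * ((geo9Y x).len y₁ ^ (1 - α) * cζ * Real.exp (-(δc * (geo9Y x).dist y₁ y'')) * M) := mul_le_mul_of_nonneg_right hle hfac
          _ = _ := by ring
      · exact hbinr ν' y'' μ M hμ
    -- (5) premise (c′) and the conclusion of the right transfer
    have concl := HR D' hmaj Φ y₁ (w₀, j₀) hp₀ α BhR cζ hBhR0 hcζ0 prema premb (fun y'' μ M hμ => by rw [hD']; exact hbinr ν y'' μ M hμ)
      yL (coordEquiv b (liftY f (E : 𝔸))) _ (hBS hE1)
    calc quotS x.toKIdx (par U) α (wordS x.toKIdx ζ₀ (TW ∘ₗ cdsSL x.toKIdx U ν) (liftY f (E : 𝔸))) z z'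
        = ‖Φ ((coordEquiv b).symm ((GopC x.toKIdx par b ((codingYx G x C37 C38).bg.mul (.mult a) (.base U)) * D')
            (coordEquiv b (liftY f (E : 𝔸)))))‖ := by
          rw [quotS_wordS_eq, hD'U, hGopW, symm_G_negGradB, LinearEquiv.symm_apply_apply, map_neg, norm_neg]; rfl
      _ ≤ _ := concl
  ------------------------------------------------------------------
  -- WRITE the (3.43) block of the reading at the product
  ------------------------------------------------------------------
  have hfacN : 0 ≤ (geo9Y x).len y ^ (1 - α) * cζ * Real.exp (-(9 / 10 * δc * (geo9Y x).dist y y')) * (geo9Y x).supNorm (Sum.inl f) :=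
    mul_nonneg (mul_nonneg (mul_nonneg (Real.rpow_nonneg hleny.le _) hcζ0) (Real.exp_pos _).le) hsupN
  have hfinal : ∀ {Bside Bh : ℝ}, 0 ≤ Bside → 0 ≤ Bh → M₂ * (Bside * Bh) ≤ wH5 (2 * ((d : ℝ) + 1)) Sb M₂ cR cLip mN B₀ BL BR δc Bβ α →
      Bside * Bh * (geo9Y x).len y₁ ^ (1 - α) * cζ * Real.exp (-(9 / 10 * δc * (geo9Y x).dist y₁ yL)) * (M₂ * (geo9Y x).supNorm (Sum.inl f)) ≤
        wH5 (2 * ((d : ℝ) + 1)) Sb M₂ cR cLip mN B₀ BL BR δc Bβ α * (geo9Y x).len y ^ (1 - α) * (geo9Y x).cutH α (Sum.inl ζ₀) *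
          Real.exp (-(9 / 10 * δc * (geo9Y x).dist y y')) * (geo9Y x).supNorm (Sum.inl f) := by
    intro Bside Bh hBs hBh hle
    rw [hlen, hdistL, ← hcζ]
    calc Bside * Bh * (geo9Y x).len y ^ (1 - α) * cζ * Real.exp (-(9 / 10 * δc * (geo9Y x).dist y y')) * (M₂ * (geo9Y x).supNorm (Sum.inl f))
        = (M₂ * (Bside * Bh)) * ((geo9Y x).len y ^ (1 - α) * cζ * Real.exp (-(9 / 10 * δc * (geo9Y x).dist y y')) * (geo9Y x).supNorm (Sum.inl f)) := by
          ring
      _ ≤ wH5 (2 * ((d : ℝ) + 1)) Sb M₂ cR cLip mN B₀ BL BR δc Bβ α *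
            ((geo9Y x).len y ^ (1 - α) * cζ * Real.exp (-(9 / 10 * δc * (geo9Y x).dist y y')) * (geo9Y x).supNorm (Sum.inl f)) :=
          mul_le_mul_of_nonneg_right hle hfacN
      _ = _ := by ring
  have hwL : M₂ * (BL * BhL) ≤ wH5 (2 * ((d : ℝ) + 1)) Sb M₂ cR cLip mN B₀ BL BR δc Bβ α := by
    show M₂ * (BL * (Sb * Bp)) ≤ M₂ * (BL * (Sb * max (Bβ α) 0) + BR * (Sb * (cR * B₀ * (1 + cLip) + max (Bβ α) 0 *
      (1 + (mN : ℝ) * (M₂ * Sb) * Real.exp (δc * (2 * ((d : ℝ) + 1)))))))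
    rw [← hBp]
    exact mul_le_mul_of_nonneg_left (le_add_of_nonneg_right (by positivity)) hM₂
  have hwR : M₂ * (BR * BhR) ≤ wH5 (2 * ((d : ℝ) + 1)) Sb M₂ cR cLip mN B₀ BL BR δc Bβ α := by
    show M₂ * (BR * BhR) ≤ M₂ * (BL * (Sb * max (Bβ α) 0) + BR * (Sb * (cR * B₀ * (1 + cLip) + max (Bβ α) 0 *
      (1 + (mN : ℝ) * (M₂ * Sb) * Real.exp (δc * (2 * ((d : ℝ) + 1)))))))
    rw [← hBp, ← hBhR]
    exact mul_le_mul_of_nonneg_left (le_add_of_nonneg_left (by positivity)) hM₂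
  exact h1ReadT_le_of_probes x.toKIdx TW (par U) U f α ζ₀ hRHS
    (fun E ν z z' hne => (hLeft E ν z z' hne).trans (hfinal hBL hBhL0 hwL))
    (fun E ν z z' hne => (hRight E ν z z' hne).trans (hfinal hBR hBhR0 hwR))

end Transfer

/-! ## §4 ★★ The frame instance over the coded carriers of a subfamily and the (3.43) block-steps -/

section Steps

variable [NormOneClass 𝔸] {J : Type} (f : J → MemberY d ℓ hd hL b₀ b₁ Mstar) [∀ x : MemberY d ℓ hd hL b₀ b₁ Mstar, Fintype (geo9Y x).Site]
  [instDS : ∀ x : MemberY d ℓ hd hL b₀ b₁ Mstar, DecidableEq (geo9Y x).Site] [instNE : ∀ x : MemberY d ℓ hd hL b₀ b₁ Mstar, Nonempty (geo9Y x).Site]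
  (c35 : ℝ) (G : Subgroup 𝔸ˣ) (par : ∀ j : J, SiteParY 𝔸 (f j).toKIdx) (OA : ∀ j : J, BondOpY 𝔸 (f j).toKIdx)
  (parB : ∀ j : J, BondParY 𝔸 (f j).toKIdx) {ι : Type} [Fintype ι] [DecidableEq ι] (b : Module.Basis ι ℝ 𝔸)
  (ιB : ∀ j : J, BlkY (f j).toKIdx → IBondY (f j).toKIdx)
  (C37 C38 : ∀ j : J, ℝ → CfgY 𝔸 (f j).toKIdx → AfldY 𝔸 (f j).toKIdx → Prop)
  (Cinv : ∀ j : J, B9.SiteKernel (geo9Y (f j)) (bg9Y 𝔸 G (f j)))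

/-- ★★ **THE (3.43) FRAME OVER THE CODED CARRIERS OF A SUBFAMILY, INHABITED FOR `KSC₅`**: the root frame `gpFrame₂CodedOn` (dictionaries `read342Y_KSC₅` ∕
`write342Y_KSC₅`, reading constant `c_R = M₂Σ‖b_j‖`), the writing function `wH5`, `wHδ δc = 9δc∕10`, and the transfer field `h1_transfer_KSC₅`.  Displayed beyond
the root frame's data: the transporter law `hLip` (`Reg335 ⇒ HolderLipY c_Lip (par U) U`) and the neighbour count `hnbr` above the frame's threshold `MInv`.
[cite: Balaban1985BackgroundPropagators, Thm 3.4 p.400, (3.43) p.398, p.403 l.1–9, (3.60)–(3.65) pp.402–403; Balaban1984PropagatorsII, Lemma 2.1 p.234, (2.51)–(2.52) p.232] -/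
noncomputable def h1Frame₃CodedOn (hι : ∀ (j : J) (s : BlkY (f j).toKIdx), β (f j).toKIdx.hN (f j).toKIdx.D (f j).toKIdx.hk (ιB j s) = s)
    (hG1 : ∀ u : 𝔸ˣ, u ∈ G → ‖(u : 𝔸)‖ ≤ 1) (hpar : ∀ j (U : CfgY 𝔸 (f j).toKIdx), GVal G (f j).toKIdx U → ∀ z w, par j U z w ∈ G)
    (hunit : ∀ j (U : CfgY 𝔸 (f j).toKIdx), GVal G (f j).toKIdx U → IsUnit (deltaPrimeAY (f j).toKIdx (par j) U))
    (dB : ℕ) (M₂ : ℝ) (hM₂ : 0 ≤ M₂) (hrepr : ∀ (v : 𝔸) (j : ι), |b.repr v j| ≤ M₂ * ‖v‖) (hcR : 0 < M₂ * ∑ j, ‖b j‖)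
    (Cq : ℝ) (hCq : 0 ≤ Cq) (hC37 : ∀ j β' U a, C37 j β' U a → GVal G (f j).toKIdx U ∧ CplxLettersY G (f j) (par j) (ιB j) Cq β' U a)
    (MInv aInv aW : ℝ) (hMInv : 0 < MInv) (haInv : 0 < aInv) (haW : 0 < aW)
    {cLip : ℝ} (hcLip : 0 ≤ cLip)
    (hLip : ∀ (j : J) (α₀ : ℝ) (U : CfgY 𝔸 (f j).toKIdx), (bg9Y 𝔸 G (f j)).Reg335 c35 α₀ U → HolderLipY (f j).toKIdx cLip (par j U) U)
    {mN : ℕ} (hnbr : ∀ j : J, MInv ≤ (geo9Y (f j)).M → ∀ y' : IBondY (f j).toKIdx, (nbr (geo9Y (f j)) (2 * ((d : ℝ) + 1)) y').card ≤ mN) :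
    H1Frame₃ c35 (fun j => geo9Y (f j)) (fun j => (codingYx G (f j) (C37 j) (C38 j)).bg) (fun j => KSC₅ G (f j) (par j) (C37 j) (C38 j)) b
      (Fin (d + 1)) (fun j => SiteY (f j).toKIdx) :=
  { gpFrame₂CodedOn f c35 G b C37 C38 par ιB (fun j => KSC₅ G (f j) (par j) (C37 j) (C38 j)) hι hG1 hpar hunit dB M₂ hM₂ hrepr Cq hCq hC37
      (M₂ * ∑ j, ‖b j‖) hcR (fun B _ => (M₂ * ∑ j, ‖b j‖) * B + 1) (fun B _ hB _ => by positivity) (fun δ => δ) (fun δ hδ => hδ)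
      MInv aInv aW hMInv haInv haW (fun j => read342Y_KSC₅ G (f j) (par j) b (ιB j) (C37 j) (C38 j) (hι j) M₂ hM₂ hrepr c35 MInv aInv)
      (fun j => write342Y_KSC₅ G (f j) (par j) b (ιB j) (C37 j) (C38 j) (hι j) M₂ hM₂ hrepr aW fun β' U a h => (hC37 j β' U a h).1) with
    wH := fun B₀ BL BR δc Bβ => wH5 (2 * ((d : ℝ) + 1)) (∑ j, ‖b j‖) M₂ (M₂ * ∑ j, ‖b j‖) cLip mN B₀ BL BR δc Bβ
    wHδ := fun δc => 9 / 10 * δc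
    wHδ_pos := fun δc hδc => by positivity
    h1_transfer := fun j α₀ c c' α₁ B₀ BL BR δ δc Bβ hM hα₀ hMa hreg hα₁ haW' h37 hB₀ hBL hBR hδ hδc hδcδ hE hH1 HL HR =>
      h1_transfer_KSC₅ c35 G (f j) (par j) b (ιB j) (C37 j) (C38 j) (hι j) hG1 (hpar j) hM₂ hrepr hcLip (hLip j) (hnbr j) hcR
        (read342Y_KSC₅ G (f j) (par j) b (ιB j) (C37 j) (C38 j) (hι j) M₂ hM₂ hrepr c35 MInv aInv)
        α₀ c c' α₁ B₀ BL BR δ δc Bβ hM hα₀ hMa hreg hα₁ haW' h37 hB₀ hBL hBR hδ hδc hδcδ hE hH1 HL HR }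

/-- ★★ **`StepH1Pos` OF `KSC₅` OVER THE CODED CARRIERS** (any shared `GA`, `Cinv` over the coded background): `stepH1Pos_of_h1Frame₃` on `h1Frame₃CodedOn`.
[cite: Balaban1985BackgroundPropagators, Thm 3.4 p.400, Thm 3.1 (3.43) p.398, (3.60)–(3.65) pp.402–403; Balaban1984PropagatorsII, Lemma 2.1 p.234] -/
theorem stepH1Pos_KSC₅_on (hι : ∀ (j : J) (s : BlkY (f j).toKIdx), β (f j).toKIdx.hN (f j).toKIdx.D (f j).toKIdx.hk (ιB j s) = s)
    (hG1 : ∀ u : 𝔸ˣ, u ∈ G → ‖(u : 𝔸)‖ ≤ 1) (hpar : ∀ j (U : CfgY 𝔸 (f j).toKIdx), GVal G (f j).toKIdx U → ∀ z w, par j U z w ∈ G)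
    (hunit : ∀ j (U : CfgY 𝔸 (f j).toKIdx), GVal G (f j).toKIdx U → IsUnit (deltaPrimeAY (f j).toKIdx (par j) U))
    (dB : ℕ) (M₂ : ℝ) (hM₂ : 0 ≤ M₂) (hrepr : ∀ (v : 𝔸) (j : ι), |b.repr v j| ≤ M₂ * ‖v‖) (hcR : 0 < M₂ * ∑ j, ‖b j‖)
    (Cq : ℝ) (hCq : 0 ≤ Cq) (hC37 : ∀ j β' U a, C37 j β' U a → GVal G (f j).toKIdx U ∧ CplxLettersY G (f j) (par j) (ιB j) Cq β' U a)
    (MInv aInv aW : ℝ) (hMInv : 0 < MInv) (haInv : 0 < aInv) (haW : 0 < aW)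
    {cLip : ℝ} (hcLip : 0 ≤ cLip)
    (hLip : ∀ (j : J) (α₀ : ℝ) (U : CfgY 𝔸 (f j).toKIdx), (bg9Y 𝔸 G (f j)).Reg335 c35 α₀ U → HolderLipY (f j).toKIdx cLip (par j U) U)
    {mN : ℕ} (hnbr : ∀ j : J, MInv ≤ (geo9Y (f j)).M → ∀ y' : IBondY (f j).toKIdx, (nbr (geo9Y (f j)) (2 * ((d : ℝ) + 1)) y').card ≤ mN)
    (GA : ∀ j : J, B9.KernelFamily (geo9Y (f j)) (codingYx G (f j) (C37 j) (C38 j)).bg)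
    (CinvC : ∀ j : J, B9.SiteKernel (geo9Y (f j)) (codingYx G (f j) (C37 j) (C38 j)).bg) :
    StepH1Pos dB c35 (fun j => geo9Y (f j)) (fun j => (codingYx G (f j) (C37 j) (C38 j)).bg) (fun j => KSC₅ G (f j) (par j) (C37 j) (C38 j)) GA CinvC
      (fun j => KSC₅ G (f j) (par j) (C37 j) (C38 j)) :=
  stepH1Pos_of_h1Frame₃ (d := dB)
    (h1Frame₃CodedOn f c35 G par b ιB C37 C38 hι hG1 hpar hunit dB M₂ hM₂ hrepr hcR Cq hCq hC37 MInv aInv aW hMInv haInv haW hcLip hLip hnbr) GA CinvC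

omit [NormOneClass 𝔸] [FiniteDimensional ℝ 𝔸] [DecidableEq ι] instDS instNE in
/-- ★ **`hin` FOR `KSC₅` WITH POSITIVE OUTPUT CONSTANTS** (input families `(KSCU, KACU, pullS Cinv)`): g11's `hin_KSCU_on_pos` (output `KSC`) followed by the
base congruence `KSC ↦ KSC₅` (every member agrees at a base). [cite: Balaban1985BackgroundPropagators, Thms 3.1–3.3 (3.42)–(3.48) pp.397–399, (3.35) p.396; Balaban1984PropagatorsII, (2.51) p.232] -/
theorem hin_KSC₅_on_pos (hι : ∀ (j : J) (s : BlkY (f j).toKIdx), β (f j).toKIdx.hN (f j).toKIdx.D (f j).toKIdx.hk (ιB j s) = s)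
    (hG1 : ∀ u : 𝔸ˣ, u ∈ G → ‖(u : 𝔸)‖ ≤ 1) {M₂ : ℝ} (hM₂ : 0 ≤ M₂) (hrepr : ∀ (v : 𝔸) (j : ι), |b.repr v j| ≤ M₂ * ‖v‖) (dC : ℕ) :
    ∀ (B₀ δ₀ : ℝ) (Bβ Bε : ℝ → ℝ) (Bεβ : ℝ → ℝ → ℝ) (B₁ δ₁ : ℝ), 0 < B₀ → 0 < δ₀ → 0 < B₁ → 0 < δ₁ →
      ∃ (Mi ai B₀' δ₀' : ℝ) (Bβ' Bε' : ℝ → ℝ) (Bεβ' : ℝ → ℝ → ℝ) (B₁' δ₁' : ℝ), 0 < ai ∧ 0 < B₀' ∧ 0 < δ₀' ∧ 0 < B₁' ∧ 0 < δ₁' ∧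
        ∀ j : J, Mi ≤ (geo9Y (f j)).M → ∀ α₀ : ℝ, 0 < α₀ → (geo9Y (f j)).M * α₀ ≤ ai →
          ∀ c : (codingYx G (f j) (C37 j) (C38 j)).bg.Cfg, (codingYx G (f j) (C37 j) (C38 j)).bg.Reg335 c35 α₀ c →
          B9.Thms31to33IneqAt dC (KSCU G (f j) (par j) (C37 j) (C38 j)) (KACU G (f j) (OA j) (parB j) (C37 j) (C38 j))
              (pullS (codingYx G (f j) (C37 j) (C38 j)) (Cinv j)) B₀ δ₀ Bβ Bε Bεβ B₁ δ₁ c →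
          B9.Thms31to33IneqAt dC (KSC₅ G (f j) (par j) (C37 j) (C38 j)) (KACU G (f j) (OA j) (parB j) (C37 j) (C38 j))
              (pullS (codingYx G (f j) (C37 j) (C38 j)) (Cinv j)) B₀' δ₀' Bβ' Bε' Bεβ' B₁' δ₁' c := by
  intro B₀ δ₀ Bβ Bε Bεβ B₁ δ₁ hB₀ hδ₀ hB₁ hδ₁
  obtain ⟨Mi, ai, B₀', δ₀', Bβ', Bε', Bεβ', B₁', δ₁', hai, hB₀', hδ₀', hB₁', hδ₁', H⟩ :=
    hin_KSCU_on_pos f c35 G par OA parB b ιB C37 C38 Cinv hι hG1 hM₂ hrepr dC B₀ δ₀ Bβ Bε Bεβ B₁ δ₁ hB₀ hδ₀ hB₁ hδ₁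
  refine ⟨Mi, ai, B₀', δ₀', Bβ', Bε', Bεβ', B₁', δ₁', hai, hB₀', hδ₀', hB₁', hδ₁', fun j hM α₀ hα₀ hMa c hreg hT => ?_⟩
  obtain ⟨U, rfl, -⟩ := (codingYx G (f j) (C37 j) (C38 j)).exists_of_bg_Reg335 hreg
  obtain ⟨⟨h42, h43⟩, hC, hG⟩ := H j hM α₀ hα₀ hMa _ hreg hT
  obtain ⟨se, sh1, se4, sh2, sl2, sg⟩ := KSC₅_members_base G (f j) (par j) (C37 j) (C38 j) U
  exact ⟨⟨ineq342_346_347_congr G (f j) (C37 j) (C38 j) _ _ (fun n => (se n).symm) (fun n => (sl2 n).symm) (fun n => (sg n).symm) _ _ h42,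
    ineq343_345_congr G (f j) (C37 j) (C38 j) _ _ sh1.symm se4.symm sh2.symm _ _ _ _ h43⟩, hC, hG⟩

/-- ★★ **`StepH1Pos` OF `KSCU` OVER THE CODED CARRIER — THE (3.43) MEMBER OF THE SECT.-B STEP OF RECORD IN PRINT's READING (R13-U1), G′ SIDE** (input
families `(KSCU, KACU, pullS Cinv)`, output `KSCU`'s (3.43) block at the product): `stepH1Pos_KSC₅_on` (with `GA := KACU`, `Cinv := pullS Cinv`) transported by
`stepH1Pos_of_family_pos` — `hin_KSC₅_on_pos`, identity output (`KSC₅.h1 = KSCU.h1`).  The neighbour count is taken above its own threshold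
(`exists_card_nbr_geo9Y_le_of_M`, folded into the frame's `MInv`).  Displayed beyond `B9SectBStepsKSCUBlocks.stepEPos_KSCU_on`'s data: the transporter law
`hLip` (`Reg335 ⇒ HolderLipY c_Lip (par U) U`).
[cite: Balaban1985BackgroundPropagators, Thm 3.4 p.400, Thm 3.1 (3.43) p.398, (3.40) p.397, p.403 l.1–9, (3.60)–(3.65) pp.402–403, (3.35)–(3.37) p.396; Balaban1984PropagatorsII, Lemma 2.1 p.234, (2.51)–(2.52) p.232] -/
theorem stepH1Pos_KSCU_on (hι : ∀ (j : J) (s : BlkY (f j).toKIdx), β (f j).toKIdx.hN (f j).toKIdx.D (f j).toKIdx.hk (ιB j s) = s)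
    (hG1 : ∀ u : 𝔸ˣ, u ∈ G → ‖(u : 𝔸)‖ ≤ 1) (hpar : ∀ j (U : CfgY 𝔸 (f j).toKIdx), GVal G (f j).toKIdx U → ∀ z w, par j U z w ∈ G)
    (hunit : ∀ j (U : CfgY 𝔸 (f j).toKIdx), GVal G (f j).toKIdx U → IsUnit (deltaPrimeAY (f j).toKIdx (par j) U))
    (dB : ℕ) (M₂ : ℝ) (hM₂ : 0 ≤ M₂) (hrepr : ∀ (v : 𝔸) (j : ι), |b.repr v j| ≤ M₂ * ‖v‖) (hcR : 0 < M₂ * ∑ j, ‖b j‖)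
    (Cq : ℝ) (hCq : 0 ≤ Cq) (hC37 : ∀ j β' U a, C37 j β' U a → GVal G (f j).toKIdx U ∧ CplxLettersY G (f j) (par j) (ιB j) Cq β' U a)
    (MInv aInv aW : ℝ) (hMInv : 0 < MInv) (haInv : 0 < aInv) (haW : 0 < aW)
    {cLip : ℝ} (hcLip : 0 ≤ cLip)
    (hLip : ∀ (j : J) (α₀ : ℝ) (U : CfgY 𝔸 (f j).toKIdx), (bg9Y 𝔸 G (f j)).Reg335 c35 α₀ U → HolderLipY (f j).toKIdx cLip (par j U) U) :
    StepH1Pos dB c35 (fun j => geo9Y (f j)) (fun j => (codingYx G (f j) (C37 j) (C38 j)).bg)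
      (fun j => KSCU G (f j) (par j) (C37 j) (C38 j)) (fun j => KACU G (f j) (OA j) (parB j) (C37 j) (C38 j))
      (fun j => pullS (codingYx G (f j) (C37 j) (C38 j)) (Cinv j)) (fun j => KSCU G (f j) (par j) (C37 j) (C38 j)) := by
  obtain ⟨ML, mN, hcnt⟩ := exists_card_nbr_geo9Y_le_of_M (d := d) (ℓ := ℓ) (hd := hd) (hL := hL) (b₀ := b₀) (b₁ := b₁) (2 * ((d : ℝ) + 1))
  have hMInv' : 0 < max MInv ML := lt_max_of_lt_left hMInv
  have hnbr : ∀ j : J, max MInv ML ≤ (geo9Y (f j)).M → ∀ y' : IBondY (f j).toKIdx, (nbr (geo9Y (f j)) (2 * ((d : ℝ) + 1)) y').card ≤ mN :=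
    fun j hM y' => hcnt Mstar (f j) (le_trans (le_max_right _ _) hM) y'
  refine stepH1Pos_of_family_pos dB c35 (fun j => geo9Y (f j)) (fun j => (codingYx G (f j) (C37 j) (C38 j)).bg)
    (fun j => KSC₅ G (f j) (par j) (C37 j) (C38 j)) (fun j => KSCU G (f j) (par j) (C37 j) (C38 j))
    (fun j => KACU G (f j) (OA j) (parB j) (C37 j) (C38 j)) (fun j => KACU G (f j) (OA j) (parB j) (C37 j) (C38 j))
    (fun j => pullS (codingYx G (f j) (C37 j) (C38 j)) (Cinv j))
    (fun j => KSC₅ G (f j) (par j) (C37 j) (C38 j)) (fun j => KSCU G (f j) (par j) (C37 j) (C38 j))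
    (hin_KSC₅_on_pos f c35 G par OA parB b ιB C37 C38 Cinv hι hG1 hM₂ hrepr dB)
    (fun Bβ δ a hδ ha => ⟨0, 1, a, Bβ, δ, one_pos, ha, le_rfl, hδ, fun j _ _ _ _ _ _ _ _ _ _ _ h => (h1Block_KSC₅_iff G (f j) (par j) (C37 j) (C38 j) _).1 h⟩)
    (stepH1Pos_KSC₅_on f c35 G par b ιB C37 C38 hι hG1 hpar hunit dB M₂ hM₂ hrepr hcR Cq hCq hC37 (max MInv ML) aInv aW hMInv' haInv haW hcLip
      hLip hnbr _ _)

end Steps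

end Literature.MathematicalPhysics.QuantumFieldTheory.Balaban1983to89.B9SectBH1FrameCodedY

end
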